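import Literature.NumberTheory.Automorphic.SpreadProjectorWhittaker
import Literature.NumberTheory.Automorphic.ArchIsotypicTransfer
import Literature.NumberTheory.Automorphic.UnramifiedHeckeScalarsProofs
import Literature.NumberTheory.Automorphic.UnramifiedHeckeLevel
import Literature.NumberTheory.Automorphic.LocalTestFunctionTestClass
import Literature.NumberTheory.Automorphic.GLnCuspidalSpectrumSiegelProofs
import Literature.NumberTheory.Automorphic.SmoothedVectorUnderMaximalCompact
import Literature.NumberTheory.Automorphic.RankinSelbergTorusPointwise
import Mathlib.Analysis.Calculus.BumpFunction.FiniteDimension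
import HarnessLib
import Literature.NumberTheory.Automorphic.ArchRankinSelbergBridge
import Literature.NumberTheory.Automorphic.SmoothedCuspFormGeneric
import Literature.NumberTheory.Automorphic.LocalComponentGeneric
import Literature.NumberTheory.Automorphic.AddCharConductorExponent
import Literature.NumberTheory.Automorphic.KirillovL2BoundFinite
import Literature.NumberTheory.Automorphic.PairLFunctionPolesEqConjThinFirstMoment

/-!
# Arthur–Clozel (2.3) / Jacquet–Shalika: the pole of `L^S(s, π × π̃)` at `s = 1` in every rank,
# from the archimedean Rankin–Selberg convergence — the spread test datum and the assembly

Topic `NumberTheory/Automorphic`; namespace `Literature.NumberTheory.Automorphic`. This file completes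
the proof, in EVERY rank `n ≥ 1`, of the named fact `JacquetShalika1981_partialPairL_pole_of_eq_conj`
(for cuspidal `π` of `GL_n(𝔸_K)` and `π' = π̄ ≅ π̃`, `(s - 1) L^S(s, π × π') → c ≠ 0` as `s → 1⁺`;
Jacquet–Shalika (1981); Arthur–Clozel (1989), Ch. 3 (2.3)) FROM Jacquet–Shalika's archimedean
convergence theorem, taken as the explicit hypothesis `hX` of the final theorems (Part 4): for every
irreducible unitary strongly continuous representation `τ` of `GL_n(K_∞)`, every continuous
`ψ_∞`-Whittaker functional on its Gårding space, every Gårding vector and all Haar measures,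
`archRankinSelbergLIntegral … < ∞` (Cogdell (2004), §3.1 item (1) with §3.2; for `n ≥ 3` this rests on
the asymptotics of archimedean Whittaker functions and is not proved in the tree; by the fact
discipline it is not vendored as a named fact here either). Ranks `n ≤ 2` are unconditional
elsewhere (`JacquetShalika1981_partialPairL_pole_of_eq_conj_holds_of_le_two`).

The finite places are treated unconditionally and elementarily by the first-moment method with THIN
test functions (`JacquetShalika1981_partialPairL_pole_of_eq_conj_of_thinFirstMoment`) and a SPREAD
test vector whose Whittaker coefficient is bi-equivariant at the bad places (support theorem of
`WhittakerBiEquivariantSupport` / `TorusIntegrandThinSupport`); the archimedean place enters only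
through the bridge `setLIntegral_unitBox_univ_torusIntegrand_lt_top` (`ArchRankinSelbergBridge`).
Parts 1–3 construct the spread datum (`exists_spreadDatum`), Part 4 assembles.

## Main statements

* `exists_archBump`, `whittakerCoeff_eq_of_isHaarMeasure`, `spreadLevelIdeal` (Part 1);
* `spreadM`, `spreadTorus`, `spreadIter` and its invariants (I1)–(I4) (Part 2);
* `exists_initialDatum`, `exists_spreadDatum` (Part 3);
* `JacquetShalika1981_partialPairL_pole_of_eq_conj_of_archRankinSelbergConvergence` (rank `n + 1`) and
  `JacquetShalika1981_partialPairL_pole_of_eq_conj_of_archRankinSelbergConvergence'` (every rank; rank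
  `0` is excluded by the hypothesis `0 < n` of the fact) (Part 4).

## References

* H. Jacquet, J. A. Shalika, *On Euler products and the classification of automorphic
  representations I, II*, Amer. J. Math. 103 (1981) [JacquetShalikaAJM1981].
* J. Arthur, L. Clozel, *Simple algebras, base change, and the advanced theory of the trace formula*
  (1989), Ch. 3 §2, (2.3) [ArthurClozelAMS120].
* J. W. Cogdell, *Analytic theory of L-functions for GL_n* (2004), §3.1–§3.2, §4.2 [CogdellAnalyticTheory2004].
* D. Bump, *Automorphic Forms and Representations* (1997), §3.3, §4.4 [Bump1997].
* J. R. Getz, H. Hahn, *An Introduction to Automorphic Representations* (2024), §6, §9.3, Def. 11.3 [GetzHahn2024].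
-/
/-! ## Part 1 — preliminaries for the spread test datum (was the draft module `SpreadDatumPrelim`) -/

/-!
# Preliminaries for the spread test datum

Topic `NumberTheory/Automorphic`; namespace `Literature.NumberTheory.Automorphic`. Plumbing for the
construction of the test datum `(f, η)` in the proof of the named fact
`JacquetShalika1981_partialPairL_pole_of_eq_conj` in every rank (`SpreadDatum`):

* `spreadProjectorCLM` — the spread projector `E_v` as a bounded operator; it commutes with
  archimedean smoothing (`spreadProjector_archIntegral`);
* `smoothedVector_archLevelWeight_eq_smul_archIntegral` — **smoothing by `β ⊗ 𝟙_{U₀}` is `c_{U₀}` times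
  archimedean smoothing** on `(1, U₀)`-fixed vectors (the vector form of
  `coe_smoothedVector_archLevelWeight_eq_smul`);
* `exists_archBump` — smooth bump functions on `GL_n(K_∞)` at `1`;
* `whittakerCoeff_eq_of_isHaarMeasure` — the global Whittaker coefficient does not depend on the
  Haar measure of `N_n(𝔸_K)` (it is normalised by the volume of the fundamental domain);
* `idealRadius_mul`, `spreadLevelIdeal` — the level ideals `𝔫₁ ∏_{w ∈ L} 𝔭_w^{k_w}` and their radii;
* translation identities for smoothed vectors and `β ⊗ 𝟙_{U₀}` under conjugation.

## References

* D. Bump, *Automorphic Forms and Representations* (1997), §3.3, §4.4 [Bump1997].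
* J. R. Getz, H. Hahn, *An Introduction to Automorphic Representations* (2024), §6, §9.3 [GetzHahn2024].
-/

noncomputable section Part_SpreadDatumPrelim

open MeasureTheory Measure NumberField NumberField.mixedEmbedding IsDedekindDomain Matrix WithZero Set Filter
open scoped MatrixGroups ComplexConjugate Topology NNReal ContDiff
open Literature.NumberTheory.Automorphic.WhittakerSupport

namespace Literature.NumberTheory.Automorphic

/-! ### `E_v` as a bounded operator; commutation with archimedean smoothing -/

section CLM

variable {n : ℕ} {K : Type} [Field K] [NumberField K] {v : HeightOneSpectrum (𝓞 K)}
variable {μ : Measure (AdelicGroupData.gl n K).automorphicQuotient} [(AdelicGroupData.gl n K).IsAutomorphicMeasure μ]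
variable {W : ContRepresentation.ClosedSubrep ((AdelicGroupData.gl n K).rightRegular μ)}
  {t : Fin n → (v.adicCompletion K)ˣ} {M : ℤ}
variable [MeasurableSpace (GL (Fin n) (v.adicCompletion K))] [BorelSpace (GL (Fin n) (v.adicCompletion K))]

attribute [local instance] glInfBorel borelSpace_glInf locallyCompactSpace_glInf secondCountableTopology_glInf

/-- **The spread projector as a bounded operator** (norm `≤ 1`). [folklore] -/
def spreadProjectorCLM
    (hψ : ∀ i j : Fin n, (i : ℕ) + 1 = j → ∀ x : v.adicCompletion K, Valued.v x ≤ exp (-M) →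
      (adeleAddChar K).adicComponent v ((t i : v.adicCompletion K) * (t j : v.adicCompletion K)⁻¹ * x) = 1) :
    W.toSubmodule →L[ℂ] W.toSubmodule :=
  LinearMap.mkContinuous
    { toFun := spreadProjector v W t M
      map_add' := spreadProjector_add hψ
      map_smul' := fun c x => spreadProjector_smul c x } 1
    fun x => by rw [one_mul]; exact norm_spreadProjector_le hψ x

/-- Unfolding of `spreadProjectorCLM`. [folklore] -/
@[simp] theorem spreadProjectorCLM_apply
    (hψ : ∀ i j : Fin n, (i : ℕ) + 1 = j → ∀ x : v.adicCompletion K, Valued.v x ≤ exp (-M) →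
      (adeleAddChar K).adicComponent v ((t i : v.adicCompletion K) * (t j : v.adicCompletion K)⁻¹ * x) = 1)
    (x : W.toSubmodule) : spreadProjectorCLM hψ x = spreadProjector v W t M x := rfl

omit [MeasurableSpace (GL (Fin n) (v.adicCompletion K))] [BorelSpace (GL (Fin n) (v.adicCompletion K))] in
/-- The archimedean smoothing integrand is integrable. [folklore] -/
theorem integrable_archSmul_toContRep {β : GL (Fin n) (mixedSpace K) → ℝ} (hβ : Continuous β)
    (hβs : HasCompactSupport β) (x : W.toSubmodule) :
    Integrable (fun h : GL (Fin n) (mixedSpace K) => (β h : ℂ) • W.toContRep (GLn.ofInfinite n K h) x) (archHaar n K) :=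
  ((Complex.continuous_ofReal.comp hβ).smul
    ((ClosedSubrep.continuous_toContRep_apply W x).comp (GLn.continuous_ofInfinite n K))).integrable_of_hasCompactSupport
    ((hβs.comp_left Complex.ofReal_zero).smul_right)

/-- **`E_v` commutes with archimedean smoothing.** [folklore] -/
theorem spreadProjector_archIntegral
    (hψ : ∀ i j : Fin n, (i : ℕ) + 1 = j → ∀ x : v.adicCompletion K, Valued.v x ≤ exp (-M) →
      (adeleAddChar K).adicComponent v ((t i : v.adicCompletion K) * (t j : v.adicCompletion K)⁻¹ * x) = 1)
    {β : GL (Fin n) (mixedSpace K) → ℝ} (hβ : Continuous β) (hβs : HasCompactSupport β) (x : W.toSubmodule) :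
    spreadProjector v W t M (∫ h, (β h : ℂ) • W.toContRep (GLn.ofInfinite n K h) x ∂(archHaar n K)) =
      ∫ h, (β h : ℂ) • W.toContRep (GLn.ofInfinite n K h) (spreadProjector v W t M x) ∂(archHaar n K) := by
  rw [← spreadProjectorCLM_apply hψ, ← ContinuousLinearMap.integral_comp_comm _ (integrable_archSmul_toContRep hβ hβs x)]
  refine integral_congr_ae (Eventually.of_forall fun h => ?_)
  dsimp only
  rw [map_smul, spreadProjectorCLM_apply, toContRep_ofInfinite_spreadProjector hψ]

end CLM

/-! ### Smoothing by `β ⊗ 𝟙_{U₀}` on `(1, U₀)`-fixed vectors -/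

section ArchLevel

variable {n : ℕ} {K : Type} [Field K] [NumberField K]
variable {μ : Measure (AdelicGroupData.gl n K).automorphicQuotient} [(AdelicGroupData.gl n K).IsAutomorphicMeasure μ]
variable {W : ContRepresentation.ClosedSubrep ((AdelicGroupData.gl n K).rightRegular μ)}
  {U₀ : Subgroup (GL (Fin n) (FiniteAdeleRing (𝓞 K) K))}

attribute [local instance] glInfBorel borelSpace_glInf locallyCompactSpace_glInf secondCountableTopology_glInf

/-- **`R(β ⊗ 𝟙_{U₀}) x = c_{U₀} ∫_{G_∞} β(h) Π((h,1)) x dh`** for `x` fixed by `(1, U₀)`. [folklore] -/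
theorem smoothedVector_archLevelWeight_eq_smul_archIntegral {β : GL (Fin n) (mixedSpace K) → ℝ}
    (hβ : Continuous β) (hβs : HasCompactSupport β)
    (hU₀o : IsOpen (U₀ : Set (GL (Fin n) (FiniteAdeleRing (𝓞 K) K))))
    (hU₀c : IsCompact (U₀ : Set (GL (Fin n) (FiniteAdeleRing (𝓞 K) K)))) {x : W.toSubmodule}
    (hx : ∀ u ∈ U₀, W.toContRep (GLn.ofFinite n K u) x = x) :
    smoothedVector W (archLevelWeight U₀ β) x =
      ((archShadowConst (n := n) (K := K) hU₀o (by rw [(U₀.isClosed_of_isOpen hU₀o).closure_eq]; exact hU₀c) : ℝ) : ℂ) •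
        ∫ h, (β h : ℂ) • W.toContRep (GLn.ofInfinite n K h) x ∂(archHaar n K) := by
  unfold smoothedVector
  have hpt : ∀ g : (AdelicGroupData.gl n K).Adelic,
      ((archLevelWeight U₀ β g : ℝ) : ℂ) • W.toContRep g x =
        ({g : (AdelicGroupData.gl n K).Adelic | GLn.sndHom n K g ∈ (U₀ : Set _)}.indicator (fun _ => (1 : ℝ)) g) •
          ((β (GLn.toMixed n K g) : ℂ) • W.toContRep (GLn.ofInfinite n K (GLn.toMixed n K g)) x) := by
    intro g
    by_cases hg : GLn.sndHom n K g ∈ U₀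
    · rw [archLevelWeight_of_mem β hg, indicator_of_mem (show g ∈ {g : (AdelicGroupData.gl n K).Adelic |
          GLn.sndHom n K g ∈ (U₀ : Set _)} from hg), one_smul]
      congr 1
      conv_lhs => rw [← GLn.ofInfinite_toMixed_mul_ofFinite_sndHom g]
      rw [ClosedSubrep.toContRep_mul_apply, hx _ hg]
    · rw [archLevelWeight_of_not_mem β hg, indicator_of_notMem (show g ∉ {g : (AdelicGroupData.gl n K).Adelic |
          GLn.sndHom n K g ∈ (U₀ : Set _)} from hg), Complex.ofReal_zero, zero_smul, zero_smul]
  simp_rw [hpt]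
  have hF : Continuous fun h : GL (Fin n) (mixedSpace K) => (β h : ℂ) • W.toContRep (GLn.ofInfinite n K h) x :=
    (Complex.continuous_ofReal.comp hβ).smul
      ((ClosedSubrep.continuous_toContRep_apply W x).comp (GLn.continuous_ofInfinite n K))
  have hFs : HasCompactSupport fun h : GL (Fin n) (mixedSpace K) => (β h : ℂ) • W.toContRep (GLn.ofInfinite n K h) x :=
    (hβs.comp_left Complex.ofReal_zero).smul_right
  refine (integral_indicator_smul_comp_toMixed_eq_smul hU₀o
    (by rw [(U₀.isClosed_of_isOpen hU₀o).closure_eq]; exact hU₀c) hF hFs).trans ?_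
  rw [Complex.coe_smul]
  rfl

end ArchLevel

/-! ### Smooth bumps on `GL_n(K_∞)` -/

section Bump

variable {n : ℕ} {K : Type} [Field K] [NumberField K]

open scoped Matrix.Norms.Operator Classical

attribute [local instance] finiteDimensional_matrix_mixedSpace

-- Mathlib idiom: the commutator Lie ring on matrices, to mention `(archGroupGL n K).lie`
attribute [local instance 100] LieRing.ofAssociativeRing

set_option synthInstance.maxHeartbeats 200000 in
set_option backward.isDefEq.respectTransparency false in
/-- **Smoothness along `u exp X` of a smooth function of the matrix.** [folklore] -/
theorem contDiff_coe_comp_mul_expGL {ψ : Matrix (Fin n) (Fin n) (mixedSpace K) → ℝ} (hψ : ContDiff ℝ ∞ ψ)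
    (u : GL (Fin n) (mixedSpace K)) :
    ContDiff ℝ ∞ (fun X : (archGroupGL n K).lie.toSubmodule =>
      ψ ((u : Matrix (Fin n) (Fin n) (mixedSpace K)) * NormedSpace.exp (X : Matrix (Fin n) (Fin n) (mixedSpace K)))) := by
  have hval : ContDiff ℝ ∞ fun X : (archGroupGL n K).lie.toSubmodule => (X : Matrix (Fin n) (Fin n) (mixedSpace K)) :=
    (archGroupGL n K).lie.toSubmodule.subtypeL.contDiff
  exact hψ.comp (contDiff_const.mul ((contDiff_exp_matrix_mixedSpace (n := n) (K := K)).comp hval))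

set_option synthInstance.maxHeartbeats 200000 in
set_option backward.isDefEq.respectTransparency false in
/-- **Conjugating a smooth function of the matrix by fixed invertible matrices keeps it smooth.**
[folklore] -/
theorem contDiff_comp_conj {ψ : Matrix (Fin n) (Fin n) (mixedSpace K) → ℝ} (hψ : ContDiff ℝ ∞ ψ)
    (A B : Matrix (Fin n) (Fin n) (mixedSpace K)) :
    ContDiff ℝ ∞ fun X : Matrix (Fin n) (Fin n) (mixedSpace K) => ψ (A * X * B) :=
  hψ.comp ((contDiff_const.mul contDiff_id).mul contDiff_const)

set_option synthInstance.maxHeartbeats 200000 in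
set_option backward.isDefEq.respectTransparency false in
/-- **Smooth bump functions at `1` on `GL_n(K_∞)`**: for `N ∈ 𝓝 1` there is a smooth `ψ` on
`M_n(K_∞)` whose restriction `β = ψ|_{GL_n}` is `≥ 0`, compactly supported in `N`, with `β 1 = 1`
(Mathlib `exists_contDiff_tsupport_subset`, `Units.val` an open embedding). [folklore] -/
theorem exists_archBump {N : Set (GL (Fin n) (mixedSpace K))} (hN : N ∈ 𝓝 (1 : GL (Fin n) (mixedSpace K))) :
    ∃ ψ : Matrix (Fin n) (Fin n) (mixedSpace K) → ℝ, ContDiff ℝ ∞ ψ ∧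
      HasCompactSupport (fun u : GL (Fin n) (mixedSpace K) => ψ u) ∧
      (∀ u : GL (Fin n) (mixedSpace K), 0 ≤ ψ u) ∧ ψ 1 = 1 ∧
      Function.support (fun u : GL (Fin n) (mixedSpace K) => ψ u) ⊆ N := by
  have hW : (Units.val '' N) ∈ 𝓝 (1 : Matrix (Fin n) (Fin n) (mixedSpace K)) := by
    have h := (Units.isOpenEmbedding_val (R := Matrix (Fin n) (Fin n) (mixedSpace K))).image_mem_nhds.2 hN
    rwa [Units.val_one] at h
  obtain ⟨ψ, hψsupp, hψcpt, hψsmooth, hψrange, hψ1⟩ := exists_contDiff_tsupport_subset (n := ⊤) hW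
  refine ⟨ψ, hψsmooth, ?_, fun u => (hψrange ⟨_, rfl⟩).1, hψ1, fun u hu => ?_⟩
  · exact HasCompactSupport.of_support_subset_isCompact
      ((Units.isOpenEmbedding_val (R := Matrix (Fin n) (Fin n) (mixedSpace K))).isInducing.isCompact_preimage' hψcpt
        (hψsupp.trans (image_subset_range _ _)))
      fun u hu => subset_tsupport _ hu
  · obtain ⟨u', hu', he⟩ := hψsupp (subset_tsupport _ (Function.mem_support.2 hu))
    rwa [← Units.ext he]

end Bump

/-! ### The Whittaker coefficient does not depend on the Haar measure of `N_n(𝔸_K)` -/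

section HaarIndep

variable {n : ℕ} {K : Type} [Field K] [NumberField K]

attribute [local instance] adelicBorel borelSpace_adelic locallyCompactSpace_adelic secondCountableTopology_gl_adelic
  glAdeleBorel borelSpace_glAdele

/-- **The global Whittaker coefficient is independent of the Haar measure on `N_n(𝔸_K)`** (the two
Haar measures are proportional, `isMulLeftInvariant_eq_smul`, and the coefficient does not see a
rescaling, `whittakerCoeff_smul_measure` of `RankinSelbergTorusPointwise`). [folklore] -/
theorem whittakerCoeff_eq_of_isHaarMeasure (ν₀ ν₁ : Measure ↥(adelicUnipotent n K)) [IsHaarMeasure ν₀] [IsHaarMeasure ν₁]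
    (𝓕 : Set ↥(adelicUnipotent n K)) (ψ : AddChar (AdeleRing (𝓞 K) K) Circle)
    (φ : GL (Fin n) (AdeleRing (𝓞 K) K) → ℂ) (g : GL (Fin n) (AdeleRing (𝓞 K) K)) :
    whittakerCoeff ν₁ 𝓕 ψ φ g = whittakerCoeff ν₀ 𝓕 ψ φ g := by
  have h := isMulLeftInvariant_eq_smul ν₁ ν₀
  have hpos := haarScalarFactor_pos_of_isHaarMeasure ν₁ ν₀
  conv_lhs => rw [h]
  rw [← Measure.coe_nnreal_smul]
  exact whittakerCoeff_smul_measure ν₀ 𝓕 ψ φ (by exact_mod_cast hpos.ne') ENNReal.coe_ne_top g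

end HaarIndep

/-! ### Level ideals -/

section Ideals

variable {K : Type} [Field K] [NumberField K]

/-- `|𝔪 𝔫|_v = |𝔪|_v |𝔫|_v` (`FractionalIdeal.count_mul`). [folklore] -/
theorem idealRadius_mul (v : HeightOneSpectrum (𝓞 K)) {𝔪 𝔫 : Ideal (𝓞 K)} (h𝔪 : 𝔪 ≠ 0) (h𝔫 : 𝔫 ≠ 0) :
    idealRadius K v (𝔪 * 𝔫) = idealRadius K v 𝔪 * idealRadius K v 𝔫 := by
  unfold idealRadius
  rw [FractionalIdeal.coeIdeal_mul, FractionalIdeal.count_mul K v (FractionalIdeal.coeIdeal_ne_zero.mpr h𝔪)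
    (FractionalIdeal.coeIdeal_ne_zero.mpr h𝔫), neg_add, WithZero.exp_add]

/-- `|𝔭_w^e|_v = 1` for `w ≠ v`. [folklore] -/
theorem idealRadius_pow_of_ne {v w : HeightOneSpectrum (𝓞 K)} (hw : v ≠ w) (e : ℕ) :
    idealRadius K v (w.asIdeal ^ e) = 1 := by
  have h := idealRadius_pow_mul_of_ne (K := K) hw e (𝔪 := ⊤) (by simp)
  rwa [Ideal.mul_top, idealRadius_top] at h

/-- **The level ideal `𝔫₁ ∏_{w ∈ L} 𝔭_w^{k_w}`.** [folklore] -/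
def spreadLevelIdeal (𝔫₁ : Ideal (𝓞 K)) (k : HeightOneSpectrum (𝓞 K) → ℕ) (L : List (HeightOneSpectrum (𝓞 K))) :
    Ideal (𝓞 K) :=
  𝔫₁ * (L.map fun w => w.asIdeal ^ k w).prod

omit [NumberField K] in
/-- The empty level ideal is `𝔫₁`. [folklore] -/
theorem spreadLevelIdeal_nil (𝔫₁ : Ideal (𝓞 K)) (k : HeightOneSpectrum (𝓞 K) → ℕ) :
    spreadLevelIdeal 𝔫₁ k [] = 𝔫₁ := by
  simp [spreadLevelIdeal]

omit [NumberField K] in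
/-- `𝔫_{v :: L} = 𝔭_v^{k_v} 𝔫_L`. [folklore] -/
theorem spreadLevelIdeal_cons (𝔫₁ : Ideal (𝓞 K)) (k : HeightOneSpectrum (𝓞 K) → ℕ) (v : HeightOneSpectrum (𝓞 K))
    (L : List (HeightOneSpectrum (𝓞 K))) :
    spreadLevelIdeal 𝔫₁ k (v :: L) = v.asIdeal ^ k v * spreadLevelIdeal 𝔫₁ k L := by
  simp only [spreadLevelIdeal, List.map_cons, List.prod_cons]
  ring

omit [NumberField K] in
/-- The prime-power product is non-zero. [folklore] -/
theorem prod_pow_ne_zero (k : HeightOneSpectrum (𝓞 K) → ℕ) (L : List (HeightOneSpectrum (𝓞 K))) :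
    (L.map fun w => w.asIdeal ^ k w).prod ≠ 0 := by
  induction L with
  | nil => simp
  | cons w L ih =>
    rw [List.map_cons, List.prod_cons]
    exact mul_ne_zero (pow_ne_zero _ w.ne_bot) ih

omit [NumberField K] in
/-- The level ideals are non-zero. [folklore] -/
theorem spreadLevelIdeal_ne_zero {𝔫₁ : Ideal (𝓞 K)} (h𝔫₁ : 𝔫₁ ≠ 0) (k : HeightOneSpectrum (𝓞 K) → ℕ)
    (L : List (HeightOneSpectrum (𝓞 K))) : spreadLevelIdeal 𝔫₁ k L ≠ 0 :=
  mul_ne_zero h𝔫₁ (prod_pow_ne_zero k L)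

omit [NumberField K] in
/-- `𝔫_L ≤ 𝔫₁`. [folklore] -/
theorem spreadLevelIdeal_le (𝔫₁ : Ideal (𝓞 K)) (k : HeightOneSpectrum (𝓞 K) → ℕ) (L : List (HeightOneSpectrum (𝓞 K))) :
    spreadLevelIdeal 𝔫₁ k L ≤ 𝔫₁ :=
  Ideal.mul_le_right

omit [NumberField K] in
/-- `𝔫_{v :: L} ≤ 𝔫_L`. [folklore] -/
theorem spreadLevelIdeal_cons_le (𝔫₁ : Ideal (𝓞 K)) (k : HeightOneSpectrum (𝓞 K) → ℕ) (v : HeightOneSpectrum (𝓞 K))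
    (L : List (HeightOneSpectrum (𝓞 K))) :
    spreadLevelIdeal 𝔫₁ k (v :: L) ≤ spreadLevelIdeal 𝔫₁ k L := by
  rw [spreadLevelIdeal_cons]
  exact Ideal.mul_le_left

/-- **The radius of `𝔫_L` at a place off `L` is that of `𝔫₁`.** [folklore] -/
theorem idealRadius_spreadLevelIdeal_of_not_mem {𝔫₁ : Ideal (𝓞 K)} (h𝔫₁ : 𝔫₁ ≠ 0) (k : HeightOneSpectrum (𝓞 K) → ℕ)
    {L : List (HeightOneSpectrum (𝓞 K))} {v : HeightOneSpectrum (𝓞 K)} (hv : v ∉ L) :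
    idealRadius K v (spreadLevelIdeal 𝔫₁ k L) = idealRadius K v 𝔫₁ := by
  induction L with
  | nil => rw [spreadLevelIdeal_nil]
  | cons w L ih =>
    rw [List.mem_cons, not_or] at hv
    rw [spreadLevelIdeal_cons, idealRadius_mul v (pow_ne_zero _ w.ne_bot) (spreadLevelIdeal_ne_zero h𝔫₁ k L),
      idealRadius_pow_of_ne hv.1, one_mul, ih hv.2]

/-- **The radius of `𝔫_{v :: L}` at `v ∉ L` is `exp(-k_v) |𝔫₁|_v`.** [folklore] -/
theorem idealRadius_spreadLevelIdeal_cons_self {𝔫₁ : Ideal (𝓞 K)} (h𝔫₁ : 𝔫₁ ≠ 0) (k : HeightOneSpectrum (𝓞 K) → ℕ)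
    {L : List (HeightOneSpectrum (𝓞 K))} {v : HeightOneSpectrum (𝓞 K)} (hv : v ∉ L) :
    idealRadius K v (spreadLevelIdeal 𝔫₁ k (v :: L)) = exp (-(k v : ℤ)) * idealRadius K v 𝔫₁ := by
  rw [spreadLevelIdeal_cons, idealRadius_mul v (pow_ne_zero _ v.ne_bot) (spreadLevelIdeal_ne_zero h𝔫₁ k L),
    idealRadius_pow_self, idealRadius_spreadLevelIdeal_of_not_mem h𝔫₁ k hv]

/-- **The prime factors of `𝔫_L` are those of `𝔫₁` together with `L`.** [folklore] -/
theorem mem_or_dvd_of_dvd_spreadLevelIdeal {𝔫₁ : Ideal (𝓞 K)} (k : HeightOneSpectrum (𝓞 K) → ℕ)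
    {L : List (HeightOneSpectrum (𝓞 K))} {v : HeightOneSpectrum (𝓞 K)} (hv : v.asIdeal ∣ spreadLevelIdeal 𝔫₁ k L) :
    v.asIdeal ∣ 𝔫₁ ∨ v ∈ L := by
  induction L with
  | nil => rw [spreadLevelIdeal_nil] at hv; exact Or.inl hv
  | cons w L ih =>
    rw [spreadLevelIdeal_cons] at hv
    rcases v.prime.dvd_or_dvd hv with h | h
    · right
      have h1 : v.asIdeal ∣ w.asIdeal := v.prime.dvd_of_dvd_pow h
      have h2 : w.asIdeal = v.asIdeal :=
        w.isMaximal.eq_of_le v.isPrime.ne_top (Ideal.le_of_dvd h1)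
      have hvw : v = w := HeightOneSpectrum.ext h2.symm
      rw [hvw]
      exact List.mem_cons_self
    · rcases ih h with h' | h'
      · exact Or.inl h'
      · exact Or.inr (List.mem_cons_of_mem _ h')

end Ideals

end Literature.NumberTheory.Automorphic

end Part_SpreadDatumPrelim

/-! ## Part 2 — the spread test datum: parameters and the iterated projector (draft module `SpreadDatum`) -/

/-!
# The spread test datum: parameters and the iterated projector

Topic `NumberTheory/Automorphic`; namespace `Literature.NumberTheory.Automorphic`. For the proof of
the named fact `JacquetShalika1981_partialPairL_pole_of_eq_conj` in every rank: the choice of the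
torus parameters `t_i = ϖ_v^{i (M - c)}` at a finite place (`spreadTorus`, with `M = e + max(c,0) + 1`,
`c` the conductor exponent of `ψ_v`, `e` a level exponent), their valuation inequalities (the
hypotheses of `WhittakerSupport.exists_eq_unipotent_mul_integral_of_mem_cornerGL` and of
`SpreadProjector`), and the iterated projector `E_L = E_{v_1} ∘ ⋯ ∘ E_{v_r}` over a list of places
with its four invariants: commutation with the elements trivial at the places of `L`, isotypy at
every place of `L`, the level `𝔫_L = 𝔫₁ ∏ 𝔭_v^{k_v}`, and the preservation of the Gårding space and of
the value of the Whittaker functional.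

## References

* H. Jacquet, I. I. Piatetski-Shapiro, J. Shalika, *Conducteur des représentations du groupe
  linéaire*, Math. Ann. 256 (1981), §5.
* H. Jacquet, J. A. Shalika, *On Euler products and the classification of automorphic
  representations I*, Amer. J. Math. 103 (1981), §4–§5 [JacquetShalikaAJM1981].
-/

noncomputable section Part_SpreadDatum

open MeasureTheory Measure NumberField NumberField.mixedEmbedding IsDedekindDomain Matrix WithZero Set Filter
open scoped MatrixGroups ComplexConjugate Topology NNReal
open Literature.NumberTheory.Automorphic.WhittakerSupport

namespace Literature.NumberTheory.Automorphic

/-! ### The parameters at one place -/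

section Params

variable {F : Type*} [Field F] [Valued F ℤᵐ⁰]

/-- The level exponent `M = e + max(c, 0) + 1` (`M ≥ 1`, `M ≥ e + 1`, `M - c ≥ e + 1`). [folklore] -/
def spreadM (c e : ℤ) : ℤ := e + max c 0 + 1

/-- `1 ≤ M`. [folklore] -/
theorem one_le_spreadM {c e : ℤ} (he : 0 ≤ e) : 1 ≤ spreadM c e := by
  unfold spreadM; have := le_max_right c 0; omega

/-- `e ≤ M`. [folklore] -/
theorem le_spreadM (c e : ℤ) : e ≤ spreadM c e := by
  unfold spreadM; have := le_max_right c 0; omega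

/-- `e + 1 ≤ M - c`. [folklore] -/
theorem le_spreadM_sub (c e : ℤ) : e + 1 ≤ spreadM c e - c := by
  unfold spreadM; have := le_max_left c 0; omega

/-- `0 ≤ M - c`. [folklore] -/
theorem spreadM_sub_nonneg {c e : ℤ} (he : 0 ≤ e) : 0 ≤ spreadM c e - c := by
  have := le_spreadM_sub c e; omega

variable (N : ℕ)

/-- **The torus parameters `t_i = ϖ^{i (M - c)}`.** [folklore] -/
def spreadTorus (ϖ : Fˣ) (c e : ℤ) : Fin N → Fˣ := fun i => ϖ ^ ((i : ℤ) * (spreadM c e - c))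

variable {N}

/-- `|ϖ^k| = exp(-k)`. [folklore] -/
theorem valuation_uniformizer_zpow {ϖ : Fˣ} (hϖ : Valued.v (ϖ : F) = exp (-1 : ℤ)) (k : ℤ) :
    Valued.v (((ϖ ^ k : Fˣ) : F)) = exp (-k) := by
  rw [Units.val_zpow_eq_zpow_val, map_zpow₀, hϖ, ← WithZero.exp_zsmul, smul_eq_mul, mul_neg_one]

/-- `|t_i| = exp(-i (M - c))`. [folklore] -/
theorem valuation_spreadTorus {ϖ : Fˣ} (hϖ : Valued.v (ϖ : F) = exp (-1 : ℤ)) (c e : ℤ) (i : Fin N) :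
    Valued.v ((spreadTorus N ϖ c e i : Fˣ) : F) = exp (-((i : ℤ) * (spreadM c e - c))) :=
  valuation_uniformizer_zpow hϖ _

/-- `|t_i t_j⁻¹| = exp((j - i)(M - c))`. [folklore] -/
theorem valuation_spreadTorus_mul_inv {ϖ : Fˣ} (hϖ : Valued.v (ϖ : F) = exp (-1 : ℤ)) (c e : ℤ) (i j : Fin N) :
    Valued.v ((spreadTorus N ϖ c e i : F) * ((spreadTorus N ϖ c e j : Fˣ) : F)⁻¹) =
      exp (((j : ℤ) - i) * (spreadM c e - c)) := by
  rw [Valuation.map_mul, map_inv₀, valuation_spreadTorus hϖ, valuation_spreadTorus hϖ, ← WithZero.exp_neg, ← exp_add]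
  congr 1
  ring

/-- **(T2) `ψ(t_i t_{i+1}⁻¹ 𝔭^M) = 1`** when `ψ(𝔭^c) = 1`. [folklore] -/
theorem addChar_spreadTorus_ratio_eq_one (ψ : AddChar F Circle) {c e : ℤ}
    (hψc : ∀ y : F, Valued.v y ≤ exp (-c) → ψ y = 1) {ϖ : Fˣ} (hϖ : Valued.v (ϖ : F) = exp (-1 : ℤ)) :
    ∀ i j : Fin N, (i : ℕ) + 1 = j → ∀ x : F, Valued.v x ≤ exp (-spreadM c e) →
      ψ ((spreadTorus N ϖ c e i : F) * ((spreadTorus N ϖ c e j : Fˣ) : F)⁻¹ * x) = 1 := by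
  intro i j hij x hx
  refine hψc _ ?_
  rw [Valuation.map_mul, valuation_spreadTorus_mul_inv hϖ]
  have hji : ((j : ℤ) - i) = 1 := by have := hij; push_cast [← this]; ring
  rw [hji, one_mul]
  calc exp (spreadM c e - c) * Valued.v x ≤ exp (spreadM c e - c) * exp (-spreadM c e) := mul_le_mul' le_rfl hx
    _ = exp (-c) := by rw [← exp_add]; congr 1; ring

/-- **(T3) the lower ratios are small**: `|t_i t_j⁻¹| ≤ exp(-e)` for `j < i`. [folklore] -/
theorem valuation_spreadTorus_ratio_le {c e : ℤ} (he : 0 ≤ e) {ϖ : Fˣ} (hϖ : Valued.v (ϖ : F) = exp (-1 : ℤ)) :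
    ∀ i j : Fin N, j < i → Valued.v ((spreadTorus N ϖ c e i : F) * ((spreadTorus N ϖ c e j : Fˣ) : F)⁻¹) ≤ exp (-e) := by
  intro i j hji
  rw [valuation_spreadTorus_mul_inv hϖ, exp_le_exp]
  have h1 : (1 : ℤ) ≤ (i : ℤ) - j := by have := Fin.lt_def.1 hji; omega
  have h2 := le_spreadM_sub c e
  have h3 := spreadM_sub_nonneg (c := c) he
  nlinarith

/-- **(T4) monotonicity**: `|t_j| ≤ |t_i|` for `i ≤ j`. [folklore] -/
theorem valuation_spreadTorus_antitone {c e : ℤ} (he : 0 ≤ e) {ϖ : Fˣ} (hϖ : Valued.v (ϖ : F) = exp (-1 : ℤ)) :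
    ∀ i j : Fin N, i ≤ j → Valued.v ((spreadTorus N ϖ c e j : Fˣ) : F) ≤ Valued.v ((spreadTorus N ϖ c e i : Fˣ) : F) := by
  intro i j hij
  rw [valuation_spreadTorus hϖ, valuation_spreadTorus hϖ, exp_le_exp]
  have h1 : (i : ℤ) ≤ j := by exact_mod_cast Fin.le_def.1 hij
  have h3 := spreadM_sub_nonneg (c := c) he
  nlinarith

/-- **(T5) the gaps**: `exp(M - c) |t_j| ≤ |t_i|` for `i + 1 = j`. [folklore] -/
theorem valuation_spreadTorus_gap {c e : ℤ} {ϖ : Fˣ} (hϖ : Valued.v (ϖ : F) = exp (-1 : ℤ)) :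
    ∀ i j : Fin N, (i : ℕ) + 1 = j →
      exp (spreadM c e - c) * Valued.v ((spreadTorus N ϖ c e j : Fˣ) : F) ≤ Valued.v ((spreadTorus N ϖ c e i : Fˣ) : F) := by
  intro i j hij
  rw [valuation_spreadTorus hϖ, valuation_spreadTorus hϖ, ← exp_add, exp_le_exp]
  have hji : (j : ℤ) = i + 1 := by have := hij; push_cast [← this]; ring
  rw [hji]
  nlinarith

/-- **(T6) the ratio bound** `|t_i t_j⁻¹| ≤ exp(N (M - c))`. [folklore] -/
theorem valuation_spreadTorus_ratio_le_R {c e : ℤ} (he : 0 ≤ e) {ϖ : Fˣ} (hϖ : Valued.v (ϖ : F) = exp (-1 : ℤ)) :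
    ∀ i j : Fin N, Valued.v ((spreadTorus N ϖ c e i : F) * ((spreadTorus N ϖ c e j : Fˣ) : F)⁻¹) ≤
      exp ((N : ℤ) * (spreadM c e - c)) := by
  intro i j
  rw [valuation_spreadTorus_mul_inv hϖ, exp_le_exp]
  have h1 : (j : ℤ) - i ≤ N := by have := j.2; omega
  have h3 := spreadM_sub_nonneg (c := c) he
  nlinarith

/-- **(T7) the depth condition** `exp(-m) |t_0| ≤ exp(-M) |t_last|` for `m ≥ M + n (M - c)`
(rank `n + 1`). [folklore] -/
theorem valuation_spreadTorus_depth {n : ℕ} {c e : ℤ} {ϖ : Fˣ} (hϖ : Valued.v (ϖ : F) = exp (-1 : ℤ))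
    {m : ℕ} (hm : spreadM c e + n * (spreadM c e - c) ≤ m) :
    exp (-(m : ℤ)) * Valued.v ((spreadTorus (n + 1) ϖ c e 0 : Fˣ) : F) ≤
      exp (-spreadM c e) * Valued.v ((spreadTorus (n + 1) ϖ c e (Fin.last n) : Fˣ) : F) := by
  rw [valuation_spreadTorus hϖ, valuation_spreadTorus hϖ, ← exp_add, ← exp_add, exp_le_exp, Fin.val_zero, Fin.val_last]
  push_cast
  nlinarith

/-- The natural number `k = 2 N (M - c)` of extra level at the place. [folklore] -/
def spreadK (N : ℕ) (c e : ℤ) : ℕ := (2 * (N : ℤ) * (spreadM c e - c)).toNat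

/-- `k = 2 N (M - c)` in `ℤ`. [folklore] -/
theorem spreadK_cast {N : ℕ} {c e : ℤ} (he : 0 ≤ e) : (spreadK N c e : ℤ) = 2 * (N : ℤ) * (spreadM c e - c) := by
  unfold spreadK
  rw [Int.toNat_of_nonneg]
  have := spreadM_sub_nonneg (c := c) he
  positivity

/-- `r R² = |𝔫₁|_v` for `r = exp(-k) |𝔫₁|_v`, `R = exp(N (M - c))`. [folklore] -/
theorem spreadK_radius {N : ℕ} {c e : ℤ} (he : 0 ≤ e) (ρ : ℤᵐ⁰) :
    exp (-(spreadK N c e : ℤ)) * ρ * exp ((N : ℤ) * (spreadM c e - c)) * exp ((N : ℤ) * (spreadM c e - c)) = ρ := by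
  rw [mul_comm (exp _) ρ, mul_assoc, mul_assoc, ← exp_add, ← exp_add, spreadK_cast he]
  conv_rhs => rw [← mul_one ρ]
  congr 1
  rw [← exp_zero]
  congr 1
  ring

end Params

/-! ### The hypotheses at a place and the iterated projector -/

section Iter

variable {n : ℕ} {K : Type} [Field K] [NumberField K]
variable {μ : Measure (AdelicGroupData.gl n K).automorphicQuotient} [(AdelicGroupData.gl n K).IsAutomorphicMeasure μ]

attribute [local instance] adelicBorel borelSpace_adelic locallyCompactSpace_adelic secondCountableTopology_gl_adelic
  glAdeleBorel borelSpace_glAdele glInfBorel borelSpace_glInf locallyCompactSpace_glInf secondCountableTopology_glInf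

/-- The Borel structure of `GL_n(K_v)` (local instance). [folklore] -/
@[reducible] def glLocalBorel (v : HeightOneSpectrum (𝓞 K)) : MeasurableSpace (GL (Fin n) (v.adicCompletion K)) := borel _

/-- `glLocalBorel` is a Borel structure (local instance). [folklore] -/
theorem borelSpace_glLocal (v : HeightOneSpectrum (𝓞 K)) : @BorelSpace (GL (Fin n) (v.adicCompletion K)) _ (glLocalBorel v) :=
  @BorelSpace.mk _ _ (glLocalBorel v) rfl

attribute [local instance] glLocalBorel borelSpace_glLocal

/-- **The hypotheses at a finite place**: `ψ_v` is trivial on `𝔭^c`, `0 ≤ e`, `c ≤ e`, and `ϖ` is a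
uniformiser. [folklore] -/
structure SpreadHyp (c e : HeightOneSpectrum (𝓞 K) → ℤ) (ϖ : ∀ v : HeightOneSpectrum (𝓞 K), (v.adicCompletion K)ˣ)
    (v : HeightOneSpectrum (𝓞 K)) : Prop where
  cond : ∀ y : v.adicCompletion K, Valued.v y ≤ exp (-c v) → (adeleAddChar K).adicComponent v y = 1
  e_nonneg : 0 ≤ e v
  c_le_e : c v ≤ e v
  unif : Valued.v ((ϖ v : (v.adicCompletion K)ˣ) : v.adicCompletion K) = exp (-1 : ℤ)

namespace SpreadHyp

variable {c e : HeightOneSpectrum (𝓞 K) → ℤ} {ϖ : ∀ v : HeightOneSpectrum (𝓞 K), (v.adicCompletion K)ˣ}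
  {v : HeightOneSpectrum (𝓞 K)} (h : SpreadHyp c e ϖ v)
include h

/-- Under `SpreadHyp`: `ψ_v(t_i t_{i+1}⁻¹ 𝔭^M) = 1`. [folklore] -/
theorem hψ : ∀ i j : Fin n, (i : ℕ) + 1 = j → ∀ x : v.adicCompletion K, Valued.v x ≤ exp (-spreadM (c v) (e v)) →
    (adeleAddChar K).adicComponent v ((spreadTorus n (ϖ v) (c v) (e v) i : v.adicCompletion K) *
      ((spreadTorus n (ϖ v) (c v) (e v) j : (v.adicCompletion K)ˣ) : v.adicCompletion K)⁻¹ * x) = 1 :=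
  addChar_spreadTorus_ratio_eq_one _ h.cond h.unif

/-- Under `SpreadHyp`: `ψ_v(𝔭^e) = 1`. [folklore] -/
theorem hψe : ∀ x : v.adicCompletion K, Valued.v x ≤ exp (-e v) → (adeleAddChar K).adicComponent v x = 1 :=
  fun x hx => h.cond x (hx.trans (exp_le_exp.2 (neg_le_neg h.c_le_e)))

/-- Under `SpreadHyp`: `|t_i / t_j| ≤ exp(-e)` for `j < i`. [folklore] -/
theorem hshrink : ∀ i j : Fin n, j < i → Valued.v ((spreadTorus n (ϖ v) (c v) (e v) i : v.adicCompletion K) *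
    ((spreadTorus n (ϖ v) (c v) (e v) j : (v.adicCompletion K)ˣ) : v.adicCompletion K)⁻¹) ≤ exp (-e v) :=
  valuation_spreadTorus_ratio_le h.e_nonneg h.unif

/-- Under `SpreadHyp`: `|t_i / t_j| ≤ exp(n (M - c))`. [folklore] -/
theorem hR : ∀ i j : Fin n, Valued.v ((spreadTorus n (ϖ v) (c v) (e v) i : v.adicCompletion K) *
    ((spreadTorus n (ϖ v) (c v) (e v) j : (v.adicCompletion K)ˣ) : v.adicCompletion K)⁻¹) ≤
      exp ((n : ℤ) * (spreadM (c v) (e v) - c v)) :=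
  valuation_spreadTorus_ratio_le_R h.e_nonneg h.unif

end SpreadHyp

variable (W : ContRepresentation.ClosedSubrep ((AdelicGroupData.gl n K).rightRegular μ))
  (c e : HeightOneSpectrum (𝓞 K) → ℤ) (ϖ : ∀ v : HeightOneSpectrum (𝓞 K), (v.adicCompletion K)ˣ)

/-- **The projector at `v` with the spread parameters.** [folklore] -/
def spreadE (v : HeightOneSpectrum (𝓞 K)) (x : W.toSubmodule) : W.toSubmodule :=
  spreadProjector v W (spreadTorus n (ϖ v) (c v) (e v)) (spreadM (c v) (e v)) x

/-- **The iterated projector `E_L = E_{v₁} ∘ ⋯ ∘ E_{v_r}`.** [folklore] -/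
def spreadIter : List (HeightOneSpectrum (𝓞 K)) → W.toSubmodule → W.toSubmodule
  | [] => fun x => x
  | v :: L => fun x => spreadE W c e ϖ v (spreadIter L x)

variable {W c e ϖ}

/-- `E_{[]} = id`. [folklore] -/
@[simp] theorem spreadIter_nil (x : W.toSubmodule) : spreadIter W c e ϖ [] x = x := rfl

/-- `E_{v :: L} = E_v ∘ E_L`. [folklore] -/
@[simp] theorem spreadIter_cons (v : HeightOneSpectrum (𝓞 K)) (L : List (HeightOneSpectrum (𝓞 K))) (x : W.toSubmodule) :
    spreadIter W c e ϖ (v :: L) x = spreadE W c e ϖ v (spreadIter W c e ϖ L x) := rfl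

/-- **(I1) `E_L` commutes with the elements trivial at the places of `L`.** [folklore] -/
theorem toContRep_spreadIter {L : List (HeightOneSpectrum (𝓞 K))} (hL : ∀ v ∈ L, SpreadHyp c e ϖ v)
    {g : GL (Fin n) (AdeleRing (𝓞 K) K)} (hg : ∀ v ∈ L, localComponent v g = 1) (x : W.toSubmodule) :
    W.toContRep g (spreadIter W c e ϖ L x) = spreadIter W c e ϖ L (W.toContRep g x) := by
  induction L with
  | nil => rfl
  | cons v L ih =>
    rw [spreadIter_cons, spreadIter_cons, spreadE,
      toContRep_spreadProjector_of_localComponent_eq_one (hL v List.mem_cons_self).hψ (hg v List.mem_cons_self),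
      ih (fun w hw => hL w (List.mem_cons_of_mem _ hw)) (fun w hw => hg w (List.mem_cons_of_mem _ hw))]
    rfl

/-- `E_L` is homogeneous. [folklore] -/
theorem spreadIter_smul (L : List (HeightOneSpectrum (𝓞 K))) (a : ℂ) (x : W.toSubmodule) :
    spreadIter W c e ϖ L (a • x) = a • spreadIter W c e ϖ L x := by
  induction L with
  | nil => rfl
  | cons v L ih => rw [spreadIter_cons, spreadIter_cons, ih, spreadE, spreadProjector_smul]; rfl

/-- **`E_L` commutes with archimedean smoothing.** [folklore] -/
theorem spreadIter_archIntegral {L : List (HeightOneSpectrum (𝓞 K))} (hL : ∀ v ∈ L, SpreadHyp c e ϖ v)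
    {β : GL (Fin n) (mixedSpace K) → ℝ} (hβ : Continuous β) (hβs : HasCompactSupport β) (x : W.toSubmodule) :
    spreadIter W c e ϖ L (∫ h, (β h : ℂ) • W.toContRep (GLn.ofInfinite n K h) x ∂(archHaar n K)) =
      ∫ h, (β h : ℂ) • W.toContRep (GLn.ofInfinite n K h) (spreadIter W c e ϖ L x) ∂(archHaar n K) := by
  induction L with
  | nil => rfl
  | cons v L ih =>
    rw [spreadIter_cons, ih (fun w hw => hL w (List.mem_cons_of_mem _ hw)), spreadE,
      spreadProjector_archIntegral (hL v List.mem_cons_self).hψ hβ hβs]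
    rfl

/-- **(I2) isotypy at every place of `L`** (`L` without repetition). [folklore] -/
theorem isotypic_spreadIter {L : List (HeightOneSpectrum (𝓞 K))} (hL : ∀ v ∈ L, SpreadHyp c e ϖ v) (hnd : L.Nodup)
    (x : W.toSubmodule) :
    ∀ v ∈ L, ∀ h ∈ spreadLevelGroup (spreadTorus n (ϖ v) (c v) (e v)) (spreadM (c v) (e v)),
      W.toContRep (GLn.ofLocal n K v h) (spreadIter W c e ϖ L x) = spreadChar v h • spreadIter W c e ϖ L x := by
  induction L with
  | nil => intro v hv; simp at hv
  | cons w L ih =>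
    intro v hv h hh
    rw [List.nodup_cons] at hnd
    have hL' : ∀ v ∈ L, SpreadHyp c e ϖ v := fun u hu => hL u (List.mem_cons_of_mem _ hu)
    rcases List.mem_cons.1 hv with rfl | hv
    · exact toContRep_ofLocal_spreadProjector (hL v List.mem_cons_self).hψ hh _
    · have hvw : v ≠ w := fun e' => hnd.1 (e' ▸ hv)
      rw [spreadIter_cons, spreadE,
        toContRep_spreadProjector_of_localComponent_eq_one (hL w List.mem_cons_self).hψ
          (GLn.toLocal_ofLocal_of_ne (Ne.symm hvw) h), ih hL' hnd.2 v hv h hh, spreadProjector_smul]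

/-- **(I3) the level of `E_L x`**: if `x` is fixed by `K(𝔫₁)` then `E_L x` is fixed by `K(𝔫_L)`,
`𝔫_L = 𝔫₁ ∏_{v ∈ L} 𝔭_v^{k_v}`, `k_v = 2 n (M_v - c_v)`. [folklore] -/
theorem toContRep_spreadIter_of_mem_principalCongruenceLevel {𝔫₁ : Ideal (𝓞 K)} (h𝔫₁ : 𝔫₁ ≠ 0)
    {L : List (HeightOneSpectrum (𝓞 K))} (hL : ∀ v ∈ L, SpreadHyp c e ϖ v) (hnd : L.Nodup)
    {x : W.toSubmodule} (hx : ∀ g ∈ principalCongruenceLevel n K 𝔫₁, W.toContRep g x = x) :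
    ∀ g ∈ principalCongruenceLevel n K (spreadLevelIdeal 𝔫₁ (fun v => spreadK n (c v) (e v)) L),
      W.toContRep g (spreadIter W c e ϖ L x) = spreadIter W c e ϖ L x := by
  induction L with
  | nil => intro g hg; rw [spreadLevelIdeal_nil] at hg; exact hx g hg
  | cons v L ih =>
    intro g hg
    rw [List.nodup_cons] at hnd
    have hL' : ∀ v ∈ L, SpreadHyp c e ϖ v := fun u hu => hL u (List.mem_cons_of_mem _ hu)
    have hv := hL v List.mem_cons_self
    have ih' := ih hL' hnd.2
    set k : HeightOneSpectrum (𝓞 K) → ℕ := fun v => spreadK n (c v) (e v) with hk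
    have hne := spreadLevelIdeal_ne_zero h𝔫₁ k L
    have hne' := spreadLevelIdeal_ne_zero h𝔫₁ k (v :: L)
    -- split `g = ι_v(g_v) g'` with `g'` trivial at `v`
    set gv : GL (Fin n) (v.adicCompletion K) := localComponent v g with hgv
    set g' : GL (Fin n) (AdeleRing (𝓞 K) K) := g * GLn.ofLocal n K v gv⁻¹ with hg'
    have hg'1 : localComponent v g' = 1 := localComponent_mul_ofLocal_inv g
    have hgvmem : gv ∈ levelAt n K v (spreadLevelIdeal 𝔫₁ k (v :: L)) := (mem_principalCongruenceLevel_iff.1 hg).2 v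
    have hιmem : GLn.ofLocal n K v gv ∈ principalCongruenceLevel n K (spreadLevelIdeal 𝔫₁ k (v :: L)) :=
      ofLocal_mem_principalCongruenceLevel_of_mem_levelAt v hne' hgvmem
    have hιinv : GLn.ofLocal n K v gv⁻¹ ∈ principalCongruenceLevel n K (spreadLevelIdeal 𝔫₁ k (v :: L)) := by
      rw [map_inv]; exact inv_mem hιmem
    have hg'mem : g' ∈ principalCongruenceLevel n K (spreadLevelIdeal 𝔫₁ k L) :=
      principalCongruenceLevel_mono (n := n) (K := K) hne' (spreadLevelIdeal_cons_le 𝔫₁ k v L) (mul_mem hg hιinv)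
    have hgeq : g = GLn.ofLocal n K v gv * g' := by
      rw [GLn.ofLocal_mul_eq_mul_ofLocal_of_toLocal_eq_one gv hg'1, hg', mul_assoc, ← map_mul, inv_mul_cancel,
        map_one, mul_one]
    rw [hgeq, ClosedSubrep.toContRep_mul_apply, spreadIter_cons, spreadE,
      toContRep_spreadProjector_eq_self_of_localComponent_eq_one hv.hψ hg'1 (ih' g' hg'mem)]
    -- the `v`-component: `gv ∈ K_v(exp(-k_v) |𝔫₁|_v)`
    have hrad : idealRadius K v (spreadLevelIdeal 𝔫₁ k (v :: L)) = exp (-(spreadK n (c v) (e v) : ℤ)) * idealRadius K v 𝔫₁ :=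
      idealRadius_spreadLevelIdeal_cons_self h𝔫₁ k hnd.1
    have hgv' : gv ∈ valuedCongruenceSubgroup (Fin n) (exp (-(spreadK n (c v) (e v) : ℤ)) * idealRadius K v 𝔫₁) := by
      rw [← hrad]; exact hgvmem
    refine toContRep_ofLocal_spreadProjector_of_level hv.hψ hv.hR ?_ ?_ hgv'
    · rw [spreadK_radius hv.e_nonneg]
      exact idealRadius_le_one' v 𝔫₁
    · intro k' hk'
      rw [spreadK_radius hv.e_nonneg] at hk'
      refine ih' _ (ofLocal_mem_principalCongruenceLevel_of_mem_levelAt v hne ?_)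
      change k' ∈ valuedCongruenceSubgroup (Fin n) (idealRadius K v (spreadLevelIdeal 𝔫₁ k L))
      rwa [idealRadius_spreadLevelIdeal_of_not_mem h𝔫₁ k hnd.1]

/-- **(I4) `E_L` preserves the Gårding space and the Whittaker functional** for Gårding vectors of
level `K(𝔫₁)` when `exp(-e_v) ≤ |𝔫₁|_v` on `L`. [folklore] -/
theorem whittakerFunctional_spreadIter (ν₀ : Measure ↥(adelicUnipotent n K)) [IsHaarMeasure ν₀]
    {𝔫₁ : Ideal (𝓞 K)} (h𝔫₁ : 𝔫₁ ≠ 0)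
    {L : List (HeightOneSpectrum (𝓞 K))} (hL : ∀ v ∈ L, SpreadHyp c e ϖ v) (hnd : L.Nodup)
    (hrad : ∀ v ∈ L, exp (-e v) ≤ idealRadius K v 𝔫₁)
    {y : W.toSubmodule} (hy : y ∈ gardingSpace W) (hfix : ∀ g ∈ principalCongruenceLevel n K 𝔫₁, W.toContRep g y = y) :
    ∃ hE : spreadIter W c e ϖ L y ∈ gardingSpace W,
      whittakerFunctional ν₀ (continuous_adeleAddChar K) (ContRepresentation.Equiv.refl W.toContRep) ⟨spreadIter W c e ϖ L y, hE⟩ =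
        whittakerFunctional ν₀ (continuous_adeleAddChar K) (ContRepresentation.Equiv.refl W.toContRep) ⟨y, hy⟩ := by
  induction L with
  | nil => exact ⟨hy, rfl⟩
  | cons v L ih =>
    rw [List.nodup_cons] at hnd
    have hL' : ∀ v ∈ L, SpreadHyp c e ϖ v := fun u hu => hL u (List.mem_cons_of_mem _ hu)
    have hv := hL v List.mem_cons_self
    obtain ⟨hEL, hℓL⟩ := ih hL' hnd.2 (fun u hu => hrad u (List.mem_cons_of_mem _ hu))
    have hlevel := toContRep_spreadIter_of_mem_principalCongruenceLevel h𝔫₁ hL' hnd.2 hfix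
    have hne := spreadLevelIdeal_ne_zero h𝔫₁ (fun v => spreadK n (c v) (e v)) L
    have hfixv : ∀ k ∈ valuedCongruenceSubgroup (Fin n) (exp (-e v)),
        W.toContRep (GLn.ofLocal n K v k) (spreadIter W c e ϖ L y) = spreadIter W c e ϖ L y := by
      intro k hk
      refine hlevel _ (ofLocal_mem_principalCongruenceLevel_of_mem_levelAt v hne ?_)
      change k ∈ valuedCongruenceSubgroup (Fin n) (idealRadius K v (spreadLevelIdeal 𝔫₁ _ L))
      rw [idealRadius_spreadLevelIdeal_of_not_mem h𝔫₁ _ hnd.1]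
      exact valuedCongruenceSubgroup_mono (Fin n) (hrad v List.mem_cons_self) hk
    obtain ⟨hE, hℓ⟩ := whittakerFunctional_spreadProjector ν₀ (W := W) (one_le_spreadM hv.e_nonneg) hv.e_nonneg
      (le_spreadM (c v) (e v)) hv.hψ hv.hψe hv.hshrink hEL hfixv
    exact ⟨hE, hℓ.trans hℓL⟩

end Iter

end Literature.NumberTheory.Automorphic

end Part_SpreadDatum

/-! ## Part 3 — the spread test datum: initial datum and assembly (draft module `SpreadDatumFinal`) -/

/-!
# The spread test datum of a cuspidal automorphic representation

Topic `NumberTheory/Automorphic`; namespace `Literature.NumberTheory.Automorphic`. The construction of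
the test datum `(f, η)` of the proof of the named fact `JacquetShalika1981_partialPairL_pole_of_eq_conj`
in every rank (Jacquet–Shalika (1981), §4–§5; Arthur–Clozel (1989), Ch. 3 (2.3)):

* `exists_initialDatum`: an initial datum `(𝔫₁, f₁, β)` — `f₁ ∈ Π` fixed by `K(𝔫₁)`, `β` a smooth bump on
  `GL_n(K_∞)` — whose smoothed vector `R(β ⊗ 𝟙_{K_f(𝔫₁)}) f₁` has non-vanishing Whittaker coefficient AT `1`
  (a non-zero level vector, a bump making the smoothing non-zero, generic non-vanishing of the
  Whittaker coefficient somewhere, and translation of the datum to `1`);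
* `exists_spreadDatum`: the datum `(T, m, 𝔫, f, η)` consumed by
  `JacquetShalika1981_partialPairL_pole_of_eq_conj_of_thinFirstMoment`: `f = E_T f₁`,
  `η = β ⊗ 𝟙_{K_f(𝔫)}`, with `W_{S_η f}(1) ≠ 0` and `W_{S_η f}` spread bi-equivariant at every place of `T`.

## References

* H. Jacquet, J. A. Shalika, *On Euler products and the classification of automorphic
  representations I*, Amer. J. Math. 103 (1981), §4–§5 [JacquetShalikaAJM1981].
* J. Arthur, L. Clozel, *Simple algebras, base change, and the advanced theory of the trace
  formula* (1989), Ch. 3, (2.3) [ArthurClozelAMS120].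
* H. Jacquet, I. I. Piatetski-Shapiro, J. Shalika, *Conducteur des représentations du groupe
  linéaire*, Math. Ann. 256 (1981), §5.
-/

noncomputable section Part_SpreadDatumFinal

open MeasureTheory Measure NumberField NumberField.mixedEmbedding IsDedekindDomain Matrix WithZero Set Filter
open scoped MatrixGroups ComplexConjugate Topology NNReal ContDiff Matrix.Norms.Operator Classical
open Literature.NumberTheory.Automorphic.WhittakerSupport

namespace Literature.NumberTheory.Automorphic

section Initial

variable {n : ℕ} {K : Type} [Field K] [NumberField K]
variable {μ : Measure (AdelicGroupData.gl n K).automorphicQuotient} [(AdelicGroupData.gl n K).IsAutomorphicMeasure μ]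

attribute [local instance] adelicBorel borelSpace_adelic locallyCompactSpace_adelic secondCountableTopology_gl_adelic
  glAdeleBorel borelSpace_glAdele glInfBorel borelSpace_glInf locallyCompactSpace_glInf secondCountableTopology_glInf

variable [MeasurableSpace (AdeleRing (𝓞 K) K)] [BorelSpace (AdeleRing (𝓞 K) K)]

-- Mathlib idiom: the commutator Lie ring on matrices, to mention `(archGroupGL n K).lie`
attribute [local instance 100] LieRing.ofAssociativeRing

attribute [local instance] finiteDimensional_matrix_mixedSpace

omit [MeasurableSpace (AdeleRing (𝓞 K) K)] [BorelSpace (AdeleRing (𝓞 K) K)] in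
/-- **Conjugating `β ⊗ 𝟙_{U₀}`**: `(β ⊗ 𝟙_{U₀})(g⁻¹ x g) = (β ∘ Ad(g_∞⁻¹)) ⊗ 𝟙_{g_f U₀ g_f⁻¹} (x)`. [folklore] -/
theorem archLevelWeight_conj (U₀ : Subgroup (GL (Fin n) (FiniteAdeleRing (𝓞 K) K))) (β : GL (Fin n) (mixedSpace K) → ℝ)
    (g x : GL (Fin n) (AdeleRing (𝓞 K) K)) :
    archLevelWeight U₀ β (g⁻¹ * x * g) =
      archLevelWeight (U₀.map (MulAut.conj (GLn.sndHom n K g)).toMonoidHom)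
        (fun h => β ((GLn.toMixed n K g)⁻¹ * h * GLn.toMixed n K g)) x := by
  have hiff : GLn.sndHom n K (g⁻¹ * x * g) ∈ U₀ ↔
      GLn.sndHom n K x ∈ (U₀.map (MulAut.conj (GLn.sndHom n K g)).toMonoidHom : Subgroup _) := by
    rw [Subgroup.mem_map_equiv, MulAut.conj_symm_apply, map_mul, map_mul, map_inv]
  have htm : GLn.toMixed n K (g⁻¹ * x * g) = (GLn.toMixed n K g)⁻¹ * GLn.toMixed n K x * GLn.toMixed n K g := by
    rw [map_mul, map_mul, map_inv]
  by_cases hx : GLn.sndHom n K (g⁻¹ * x * g) ∈ U₀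
  · rw [archLevelWeight_of_mem β hx, archLevelWeight_of_mem _ (hiff.1 hx), htm]
  · rw [archLevelWeight_of_not_mem β hx, archLevelWeight_of_not_mem _ (fun h => hx (hiff.2 h))]

set_option maxHeartbeats 1600000 in
set_option synthInstance.maxHeartbeats 200000 in
set_option backward.isDefEq.respectTransparency false in
/-- **The initial datum.** For a cuspidal automorphic representation `Π` of `GL_n(𝔸_K)` (`n ≥ 1`) there
are a level `𝔫₁ ≠ 0`, a vector `f₁ ∈ Π` fixed by `K(𝔫₁)`, and a smooth `ψ` on `M_n(K_∞)` restricting to a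
compactly supported `β` on `GL_n(K_∞)`, such that the Whittaker coefficient of the smoothed vector
`R(β ⊗ 𝟙_{K_f(𝔫₁)}) f₁` does not vanish at `1`, for every Haar measure on `N_n(𝔸_K)`. [folklore] -/
theorem exists_initialDatum (P : CuspidalAutomorphicRepGL n K μ) (hn : 1 ≤ n) :
    ∃ (𝔫₁ : Ideal (𝓞 K)) (_ : 𝔫₁ ≠ 0) (f₁ : P.1.toSubmodule) (ψ : Matrix (Fin n) (Fin n) (mixedSpace K) → ℝ),
      ContDiff ℝ ∞ ψ ∧ HasCompactSupport (fun u : GL (Fin n) (mixedSpace K) => ψ u) ∧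
      (∀ g ∈ principalCongruenceLevel n K 𝔫₁, P.1.toContRep g f₁ = f₁) ∧
      ∀ (ν₀ : Measure ↥(adelicUnipotent n K)), IsHaarMeasure ν₀ →
        whittakerCoeff ν₀ (unipotentTateDomain n K) (adeleAddChar K)
          (invQuot (AdelicGroupData.gl n K)
            (smoothedForm (archLevelWeight (finitePrincipalCongruenceLevel n K 𝔫₁) (fun u : GL (Fin n) (mixedSpace K) => ψ u))
              (f₁ : (AdelicGroupData.gl n K).L2 μ))) 1 ≠ 0 := by
  classical
  have hcpt : isCompact_glFiniteIntegralLevel n K := isCompact_glFiniteIntegralLevel_holds n K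
  -- (1) a non-zero level vector
  obtain ⟨𝔫₀, h𝔫₀, x₀, hx₀, hx₀0⟩ := exists_levelPiece_ne_bot (hcpt := hcpt) P
  set f₀ : P.1.toSubmodule := ⟨x₀, (mem_levelPiece_iff.1 hx₀).1⟩ with hf₀
  have hf₀0 : f₀ ≠ 0 := fun h => hx₀0 (congrArg Subtype.val h)
  set U₀ : Subgroup (GL (Fin n) (FiniteAdeleRing (𝓞 K) K)) := finitePrincipalCongruenceLevel n K 𝔫₀ with hU₀
  have hU₀o := isOpen_finitePrincipalCongruenceLevel n K h𝔫₀
  have hU₀c := isCompact_finitePrincipalCongruenceLevel n K h𝔫₀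
  have hf₀fix : ∀ u ∈ U₀, P.1.toContRep (GLn.ofFinite n K u) f₀ = f₀ := fun u hu =>
    Subtype.ext (by rw [ContRepresentation.ClosedSubrep.coe_toContRep_apply]; exact (mem_levelPiece_iff.1 hx₀).2 u hu)
  -- (2) the neighbourhood of `1` in `G_∞` on which `R((h,1)) x₀` stays close to `x₀`, and the bump
  set N : Set (GL (Fin n) (mixedSpace K)) := {h | ‖x₀‖ ^ 2 / 2 <
    RCLike.re (inner ℂ x₀ ((AdelicGroupData.gl n K).rightRegular μ (GLn.ofInfinite n K h) x₀))} with hN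
  have hcont : Continuous fun h : GL (Fin n) (mixedSpace K) =>
      RCLike.re (inner ℂ x₀ ((AdelicGroupData.gl n K).rightRegular μ (GLn.ofInfinite n K h) x₀)) :=
    RCLike.continuous_re.comp (continuous_const.inner
      (((AdelicGroupData.isStronglyContinuous_rightRegular_holds (AdelicGroupData.gl n K) μ) x₀).comp
        (GLn.continuous_ofInfinite n K)))
  have hNo : IsOpen N := isOpen_lt continuous_const hcont
  have h1N : (1 : GL (Fin n) (mixedSpace K)) ∈ N := by
    change ‖x₀‖ ^ 2 / 2 < RCLike.re (inner ℂ x₀ ((AdelicGroupData.gl n K).rightRegular μ (GLn.ofInfinite n K 1) x₀))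
    rw [map_one, map_one]
    change ‖x₀‖ ^ 2 / 2 < RCLike.re (inner ℂ x₀ x₀)
    rw [inner_self_eq_norm_sq_to_K]
    have hpos : 0 < ‖x₀‖ ^ 2 := by rw [sq_pos_iff]; exact norm_ne_zero_iff.mpr hx₀0
    have hre : RCLike.re ((‖x₀‖ : ℂ) ^ 2) = ‖x₀‖ ^ 2 := by norm_cast
    refine lt_of_lt_of_eq (by linarith : ‖x₀‖ ^ 2 / 2 < ‖x₀‖ ^ 2) ?_
    exact_mod_cast hre.symm
  obtain ⟨ψ, hψ, hβs, hβ0, hψ1, hβN⟩ := exists_archBump (hNo.mem_nhds h1N)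
  set β : GL (Fin n) (mixedSpace K) → ℝ := fun u => ψ u with hβ
  have hβc : Continuous β := hψ.continuous.comp Units.continuous_val
  -- (3) the test function `η₀ = β ⊗ 𝟙_{U₀}` and `R(η₀) f₀ ≠ 0`
  set η₀ : GL (Fin n) (AdeleRing (𝓞 K) K) → ℝ := archLevelWeight U₀ β with hη₀def
  have hη₀ : IsTestFunctionGL n K η₀ :=
    isTestFunctionGL_archLevelWeight hβc hβs (fun u => contDiff_coe_comp_mul_expGL hψ u) hU₀o hU₀c
  have hη₀0 : 0 ≤ η₀ := archLevelWeight_nonneg hβ0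
  have hη₀1 : η₀ 1 = 1 := by
    rw [hη₀def, archLevelWeight_of_mem β (by rw [map_one]; exact one_mem _), map_one]
    exact hψ1
  have hη₀c' : Continuous fun g : (AdelicGroupData.gl n K).Adelic => η₀ g := hη₀.continuous
  have hη₀s' : HasCompactSupport fun g : (AdelicGroupData.gl n K).Adelic => η₀ g := hη₀.hasCompactSupport
  have hmass : 0 < ∫ g, η₀ g ∂(adelicHaar n K) :=
    hη₀c'.integral_pos_of_hasCompactSupport_nonneg_nonzero hη₀s' hη₀0 (by rw [hη₀1]; exact one_ne_zero)
  have hsupp : Function.support η₀ ⊆ {g | ‖((f₀ : P.1.toSubmodule) : (AdelicGroupData.gl n K).L2 μ)‖ ^ 2 / 2 <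
      RCLike.re (inner ℂ ((f₀ : P.1.toSubmodule) : (AdelicGroupData.gl n K).L2 μ)
        ((AdelicGroupData.gl n K).rightRegular μ g ((f₀ : P.1.toSubmodule) : (AdelicGroupData.gl n K).L2 μ)))} := by
    intro g hg
    have hgU : GLn.sndHom n K g ∈ U₀ := by
      by_contra h
      exact hg (archLevelWeight_of_not_mem β h)
    have hβg : β (GLn.toMixed n K g) ≠ 0 := by
      rw [Function.mem_support, hη₀def, archLevelWeight_of_mem β hgU] at hg
      exact hg
    have hN' := hβN (Function.mem_support.2 hβg)
    change ‖x₀‖ ^ 2 / 2 < RCLike.re (inner ℂ x₀ ((AdelicGroupData.gl n K).rightRegular μ g x₀))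
    have e : (AdelicGroupData.gl n K).rightRegular μ g x₀ =
        (AdelicGroupData.gl n K).rightRegular μ (GLn.ofInfinite n K (GLn.toMixed n K g)) x₀ := by
      conv_lhs => rw [← GLn.ofInfinite_toMixed_mul_ofFinite_sndHom g]
      rw [rightRegular_mul_apply, (mem_levelPiece_iff.1 hx₀).2 _ hgU]
    rw [e]
    exact hN'
  have hne : smoothedVector P.1 η₀ f₀ ≠ 0 :=
    smoothedVector_ne_zero_of_support_subset P.1 hη₀.continuous hη₀.hasCompactSupport hη₀0 hmass hf₀0 hsupp
  have hneF : smoothedForm η₀ ((f₀ : P.1.toSubmodule) : (AdelicGroupData.gl n K).L2 μ) ≠ 0 :=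
    smoothedForm_ne_zero_of_smoothedVector_ne_zero hη₀.continuous hη₀.hasCompactSupport hne
  -- (4) a Haar measure on `N_n(𝔸_K)` and a point of non-vanishing
  set ν₁ : Measure ↥(adelicUnipotent n K) := Measure.haar with hν₁
  obtain ⟨g₁, hg₁⟩ := exists_whittakerCoeff_invQuot_smoothedForm_ne_zero_of_one_le hn hη₀.continuous
    hη₀.hasCompactSupport (P.2.1 f₀.2) hneF ν₁
  -- (5) translate the datum by `g₁`
  set cf := GLn.sndHom n K g₁ with hcf
  set U' : Subgroup (GL (Fin n) (FiniteAdeleRing (𝓞 K) K)) := U₀.map (MulAut.conj cf).toMonoidHom with hU'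
  have hcoeU' : (U' : Set (GL (Fin n) (FiniteAdeleRing (𝓞 K) K))) =
      ((Homeomorph.mulLeft cf).trans (Homeomorph.mulRight cf⁻¹)) '' (U₀ : Set _) := by
    rw [hU', Subgroup.coe_map]; rfl
  have hU'o : IsOpen (U' : Set (GL (Fin n) (FiniteAdeleRing (𝓞 K) K))) := by
    rw [hcoeU']; exact (Homeomorph.isOpenMap _) _ hU₀o
  have hU'c : IsCompact (U' : Set (GL (Fin n) (FiniteAdeleRing (𝓞 K) K))) := by
    rw [hcoeU']; exact hU₀c.image (Homeomorph.continuous _)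
  set f₁ : P.1.toSubmodule := P.1.toContRep g₁ f₀ with hf₁
  have hf₁fix' : ∀ u' ∈ U', P.1.toContRep (GLn.ofFinite n K u') f₁ = f₁ := by
    intro u' hu'
    obtain ⟨u, hu, rfl⟩ := Subgroup.mem_map.1 hu'
    rw [hf₁, ← ClosedSubrep.toContRep_mul_apply, MulEquiv.coe_toMonoidHom, MulAut.conj_apply,
      GLn.ofFinite_mul_eq_mul_ofFinite_conj g₁, ClosedSubrep.toContRep_mul_apply]
    congr 1
    have : (GLn.sndHom n K g₁)⁻¹ * (cf * u * cf⁻¹) * GLn.sndHom n K g₁ = u := by rw [hcf]; group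
    rw [this, hf₀fix u hu]
  obtain ⟨𝔫₁, h𝔫₁, hle, -⟩ := exists_principalCongruenceLevel_le_of_mem_finiteLevelsGL (n := n) (K := K)
    ⟨U', hU'o, hU'c, rfl⟩ univ_mem
  have hKU' : finitePrincipalCongruenceLevel n K 𝔫₁ ≤ U' := by
    intro u hu
    obtain ⟨u', hu', he⟩ := Subgroup.mem_map.1 (hle (mem_finitePrincipalCongruenceLevel_iff.1 hu))
    have : u' = u := by
      have h := congrArg (GLn.sndHom n K) he
      rwa [GLn.sndHom_ofFinite, GLn.sndHom_ofFinite] at h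
    rwa [← this]
  have hf₁fix : ∀ g ∈ principalCongruenceLevel n K 𝔫₁, P.1.toContRep g f₁ = f₁ := by
    intro g hg
    have hg' : GLn.ofFinite n K (GLn.sndHom n K g) = g := GLn.ofFinite_sndHom_of_mem (principalCongruenceLevel_le n K 𝔫₁ hg)
    have hsnd : GLn.sndHom n K g ∈ finitePrincipalCongruenceLevel n K 𝔫₁ := by
      rw [mem_finitePrincipalCongruenceLevel_iff, hg']; exact hg
    rw [← hg']
    exact hf₁fix' _ (hKU' hsnd)
  have hf₁fixK : ∀ u ∈ finitePrincipalCongruenceLevel n K 𝔫₁, P.1.toContRep (GLn.ofFinite n K u) f₁ = f₁ :=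
    fun u hu => hf₁fix' u (hKU' hu)
  -- the conjugated bump
  set A : Matrix (Fin n) (Fin n) (mixedSpace K) :=
    (((GLn.toMixed n K g₁)⁻¹ : GL (Fin n) (mixedSpace K)) : Matrix (Fin n) (Fin n) (mixedSpace K)) with hA
  set B : Matrix (Fin n) (Fin n) (mixedSpace K) :=
    ((GLn.toMixed n K g₁ : GL (Fin n) (mixedSpace K)) : Matrix (Fin n) (Fin n) (mixedSpace K)) with hB
  set ψ₁ : Matrix (Fin n) (Fin n) (mixedSpace K) → ℝ := fun X => ψ (A * X * B) with hψ₁def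
  have hψ₁ : ContDiff ℝ ∞ ψ₁ := contDiff_comp_conj hψ A B
  set β₁ : GL (Fin n) (mixedSpace K) → ℝ := fun h => β ((GLn.toMixed n K g₁)⁻¹ * h * GLn.toMixed n K g₁) with hβ₁def
  have hβ₁c : Continuous β₁ := hβc.comp ((continuous_const.mul continuous_id).mul continuous_const)
  have hβ₁s : HasCompactSupport β₁ :=
    hβs.comp_homeomorph ((Homeomorph.mulLeft (GLn.toMixed n K g₁)⁻¹).trans (Homeomorph.mulRight (GLn.toMixed n K g₁)))
  refine ⟨𝔫₁, h𝔫₁, f₁, ψ₁, hψ₁, hβ₁s, hf₁fix, fun ν₀ hν₀ => ?_⟩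
  haveI := hν₀
  -- (6) `R(β₁ ⊗ 𝟙_{K_f(𝔫₁)}) f₁ = (c₁ / c') • R(g₁) R(η₀) f₀`
  set c₁ : ℝ := (archShadowConst (n := n) (K := K) (isOpen_finitePrincipalCongruenceLevel n K h𝔫₁)
    (by rw [((finitePrincipalCongruenceLevel n K 𝔫₁).isClosed_of_isOpen (isOpen_finitePrincipalCongruenceLevel n K h𝔫₁)).closure_eq]
        exact isCompact_finitePrincipalCongruenceLevel n K h𝔫₁) : ℝ) with hc₁
  set c' : ℝ := (archShadowConst (n := n) (K := K) hU'o (by rw [(U'.isClosed_of_isOpen hU'o).closure_eq]; exact hU'c) : ℝ) with hc'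
  have hc'pos : 0 < c' := archShadowConst_pos U' hU'o hU'c
  have hc₁pos : 0 < c₁ := archShadowConst_pos _ (isOpen_finitePrincipalCongruenceLevel n K h𝔫₁)
    (isCompact_finitePrincipalCongruenceLevel n K h𝔫₁)
  have hS1 := smoothedVector_archLevelWeight_eq_smul_archIntegral (W := P.1) (β := β₁) hβ₁c hβ₁s
    (isOpen_finitePrincipalCongruenceLevel n K h𝔫₁) (isCompact_finitePrincipalCongruenceLevel n K h𝔫₁) hf₁fixK
  have hS2 := smoothedVector_archLevelWeight_eq_smul_archIntegral (W := P.1) (β := β₁) hβ₁c hβ₁s hU'o hU'c hf₁fix'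
  have hS3 : smoothedVector P.1 (archLevelWeight U' β₁) f₁ = P.1.toContRep g₁ (smoothedVector P.1 η₀ f₀) := by
    have e1 : archLevelWeight U' β₁ = rightTranslateWeight g₁
        (fun x : GL (Fin n) (AdeleRing (𝓞 K) K) => η₀ (g₁⁻¹ * x)) := by
      funext x
      rw [rightTranslateWeight_apply, hη₀def]
      change archLevelWeight U' β₁ x = archLevelWeight U₀ β (g₁⁻¹ * (x * g₁))
      rw [← mul_assoc]
      exact (archLevelWeight_conj U₀ β g₁ x).symm
    rw [e1, smoothedVector_rightTranslateWeight, hf₁, ← ClosedSubrep.toContRep_mul_apply, inv_mul_cancel]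
    have h1 : P.1.toContRep (1 : GL (Fin n) (AdeleRing (𝓞 K) K)) f₀ = f₀ := DFunLike.congr_fun (map_one P.1.toContRep) f₀
    rw [h1]
    exact (toContRep_smoothedVector_eq _ hη₀.continuous hη₀.hasCompactSupport g₁ f₀).symm
  have hS : smoothedVector P.1 (archLevelWeight (finitePrincipalCongruenceLevel n K 𝔫₁) β₁) f₁ =
      ((c₁ * c'⁻¹ : ℝ) : ℂ) • P.1.toContRep g₁ (smoothedVector P.1 η₀ f₀) := by
    rw [hS1, ← hS3, hS2, smul_smul]
    congr 1
    push_cast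
    rw [mul_assoc, inv_mul_cancel₀ (by exact_mod_cast hc'pos.ne'), mul_one]
  -- (7) the Whittaker coefficient at `1`
  have hη₁ : IsTestFunctionGL n K (archLevelWeight (finitePrincipalCongruenceLevel n K 𝔫₁) β₁) :=
    isTestFunctionGL_archLevelWeight hβ₁c hβ₁s (fun u => contDiff_coe_comp_mul_expGL hψ₁ u)
      (isOpen_finitePrincipalCongruenceLevel n K h𝔫₁) (isCompact_finitePrincipalCongruenceLevel n K h𝔫₁)
  set u₁ := smoothedVector P.1 (archLevelWeight (finitePrincipalCongruenceLevel n K 𝔫₁) β₁) f₁ with hu₁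
  have hu₁G : u₁ ∈ gardingSpace P.1 := smoothedVector_mem_gardingSpace hη₁ f₁
  have hy₀G : smoothedVector P.1 η₀ f₀ ∈ gardingSpace P.1 := smoothedVector_mem_gardingSpace hη₀ f₀
  have hW1 := whittakerFunctional_toContRep_eq_whittakerCoeff ν₀ (continuous_adeleAddChar K) hu₁G
    (hasContRep_smoothedVector P.1 hη₁.continuous hη₁.hasCompactSupport f₁) 1
  have hWg := whittakerFunctional_toContRep_eq_whittakerCoeff ν₀ (continuous_adeleAddChar K) hy₀G
    (hasContRep_smoothedVector P.1 hη₀.continuous hη₀.hasCompactSupport f₀) g₁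
  change whittakerCoeff ν₀ (unipotentTateDomain n K) (adeleAddChar K)
    (invQuot (AdelicGroupData.gl n K) (smoothedForm (archLevelWeight (finitePrincipalCongruenceLevel n K 𝔫₁) β₁)
      (f₁ : (AdelicGroupData.gl n K).L2 μ))) 1 ≠ 0
  rw [← hW1]
  have hvec : (⟨P.1.toContRep 1 u₁, toContRep_mem_gardingSpace _ hu₁G⟩ : gardingSpace P.1) =
      ((c₁ * c'⁻¹ : ℝ) : ℂ) • ⟨P.1.toContRep g₁ (smoothedVector P.1 η₀ f₀), toContRep_mem_gardingSpace _ hy₀G⟩ := by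
    apply Subtype.ext
    change P.1.toContRep 1 u₁ = ((c₁ * c'⁻¹ : ℝ) : ℂ) • P.1.toContRep g₁ (smoothedVector P.1 η₀ f₀)
    rw [DFunLike.congr_fun (map_one P.1.toContRep) u₁]
    exact hS
  rw [hvec, map_smul, smul_eq_mul, hWg, whittakerCoeff_eq_of_isHaarMeasure ν₁ ν₀]
  exact mul_ne_zero (by exact_mod_cast (mul_pos hc₁pos (inv_pos.2 hc'pos)).ne') hg₁

end Initial

/-! ### The spread datum -/

section Final

variable {n : ℕ} {K : Type} [Field K] [NumberField K]
variable {μ : Measure (AdelicGroupData.gl (n + 1) K).automorphicQuotient} [(AdelicGroupData.gl (n + 1) K).IsAutomorphicMeasure μ]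

attribute [local instance] adelicBorel borelSpace_adelic locallyCompactSpace_adelic secondCountableTopology_gl_adelic
  glAdeleBorel borelSpace_glAdele glInfBorel borelSpace_glInf locallyCompactSpace_glInf secondCountableTopology_glInf

-- Mathlib idiom: the commutator Lie ring on matrices, to mention `(archGroupGL n K).lie`
attribute [local instance 100] LieRing.ofAssociativeRing

attribute [local instance] finiteDimensional_matrix_mixedSpace

variable {W : ContRepresentation.ClosedSubrep ((AdelicGroupData.gl (n + 1) K).rightRegular μ)}

/-- **Isotypy at `v` passes to archimedean smoothings** (`ι_v(h)` commutes with `(k, 1)` and with the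
Bochner integral). [folklore] -/
theorem isotypic_archIntegral {v : HeightOneSpectrum (𝓞 K)} {t : Fin (n + 1) → (v.adicCompletion K)ˣ} {M : ℤ}
    {y : W.toSubmodule}
    (hy : ∀ h ∈ spreadLevelGroup t M, W.toContRep (GLn.ofLocal (n + 1) K v h) y = spreadChar v h • y)
    {β : GL (Fin (n + 1)) (mixedSpace K) → ℝ} (hβ : Continuous β) (hβs : HasCompactSupport β) :
    ∀ h ∈ spreadLevelGroup t M,
      W.toContRep (GLn.ofLocal (n + 1) K v h) (∫ k, (β k : ℂ) • W.toContRep (GLn.ofInfinite (n + 1) K k) y ∂(archHaar (n + 1) K)) =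
        spreadChar v h • ∫ k, (β k : ℂ) • W.toContRep (GLn.ofInfinite (n + 1) K k) y ∂(archHaar (n + 1) K) := by
  intro h hh
  rw [← ContinuousLinearMap.integral_comp_comm _ (integrable_archSmul_toContRep hβ hβs y), ← integral_smul]
  refine integral_congr_ae (Eventually.of_forall fun k => ?_)
  dsimp only
  rw [map_smul, ← ClosedSubrep.toContRep_mul_apply,
    GLn.ofLocal_mul_eq_mul_ofLocal_of_toLocal_eq_one h (localComponent_ofInfinite k),
    ClosedSubrep.toContRep_mul_apply, hy h hh, map_smul, smul_comm]

variable [MeasurableSpace (AdeleRing (𝓞 K) K)] [BorelSpace (AdeleRing (𝓞 K) K)]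

set_option maxHeartbeats 1600000 in
set_option synthInstance.maxHeartbeats 200000 in
set_option backward.isDefEq.respectTransparency false in
/-- **The spread datum of a cuspidal automorphic representation** of `GL_{n+1}(𝔸_K)`: for every finite
set `T₀` of finite places there are `T ⊇ T₀`, a depth `m ≥ 1`, a level `𝔫 ≠ 0` with prime factors in `T`,
`f ∈ Π` and a test function `η = β ⊗ 𝟙_{K_f(𝔫)}`, left `K(𝔫)`-invariant, such that the Whittaker
coefficient of `S_η f` does not vanish at `1` and is spread bi-equivariant (`IsSpreadWhittakerAt`) at
every `v ∈ T` for torus parameters satisfying the hypotheses of the support theorem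
(`f = E_T f₁` for the initial datum `(𝔫₁, f₁, β)`, `E_T` the iterated spread projector).
[cite: JacquetShalikaAJM1981, §4–§5] [cite: ArthurClozelAMS120, Ch. 3 §2 (2.3)] -/
theorem exists_spreadDatum (P : CuspidalAutomorphicRepGL (n + 1) K μ) (T₀ : Finset (HeightOneSpectrum (𝓞 K))) :
    ∃ (T : Finset (HeightOneSpectrum (𝓞 K))) (_ : T₀ ⊆ T) (m : ℕ) (𝔫 : Ideal (𝓞 K)) (_ : 𝔫 ≠ 0)
      (_ : ∀ v : HeightOneSpectrum (𝓞 K), v.asIdeal ∣ 𝔫 → v ∈ T)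
      (f : P.1.toSubmodule) (η : GL (Fin (n + 1)) (AdeleRing (𝓞 K) K) → ℝ), IsTestFunctionGL (n + 1) K η ∧
      (∀ u ∈ finitePrincipalCongruenceLevel (n + 1) K 𝔫, ∀ g : GL (Fin (n + 1)) (AdeleRing (𝓞 K) K),
        η (GLn.ofFinite (n + 1) K u * g) = η g) ∧
      (∀ k : (AdelicGroupData.gl (n + 1) K).Adelic, k ∈ principalCongruenceLevel (n + 1) K 𝔫 →
        ∀ g : (AdelicGroupData.gl (n + 1) K).Adelic, η (k * g) = η g) ∧
      (∀ (ν₀ : Measure ↥(adelicUnipotent (n + 1) K)) (_ : IsHaarMeasure ν₀),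
        whittakerCoeff ν₀ (unipotentTateDomain (n + 1) K) (adeleAddChar K)
          (invQuot (AdelicGroupData.gl (n + 1) K) (smoothedForm η (f : (AdelicGroupData.gl (n + 1) K).L2 μ))) 1 ≠ 0) ∧
      1 ≤ m ∧
      ∀ (ν₀ : Measure ↥(adelicUnipotent (n + 1) K)) (_ : IsHaarMeasure ν₀), ∀ v ∈ T,
        ∃ (t : Fin (n + 1) → (v.adicCompletion K)ˣ) (M c₀ : ℤ),
          IsSpreadWhittakerAt v (adeleAddChar K) t M
            (whittakerCoeff ν₀ (unipotentTateDomain (n + 1) K) (adeleAddChar K)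
              (invQuot (AdelicGroupData.gl (n + 1) K) (smoothedForm η (f : (AdelicGroupData.gl (n + 1) K).L2 μ)))) ∧
          (∃ x : v.adicCompletion K, Valued.v x ≤ exp (1 - c₀) ∧ (adeleAddChar K).adicComponent v x ≠ 1) ∧ 1 ≤ M ∧
          (∀ i j : Fin (n + 1), i ≤ j → Valued.v (t j : v.adicCompletion K) ≤ Valued.v (t i : v.adicCompletion K)) ∧
          (∀ i j : Fin (n + 1), (i : ℕ) + 1 = j →
            exp (M - c₀) * Valued.v (t j : v.adicCompletion K) ≤ Valued.v (t i : v.adicCompletion K)) ∧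
          exp (-(m : ℤ)) * Valued.v (t 0 : v.adicCompletion K) ≤
            exp (-M) * Valued.v (t (Fin.last n) : v.adicCompletion K) := by
  classical
  obtain ⟨𝔫₁, h𝔫₁, f₁, ψ, hψ, hβs, hf₁fix, hW1⟩ := exists_initialDatum P (Nat.succ_pos n)
  set β : GL (Fin (n + 1)) (mixedSpace K) → ℝ := fun u => ψ u with hβdef
  have hβc : Continuous β := hψ.continuous.comp Units.continuous_val
  -- per-place data
  have hcond : ∀ v : HeightOneSpectrum (𝓞 K), ∃ d : ℤ, ((adeleAddChar K).adicComponent v).HasConductorExp d := fun v =>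
    ((isGlobalAddChar_adeleAddChar (K := K)).isContinuousNontrivial_adicComponent
      (adicComponent_adeleAddChar_ne_one v)).exists_hasConductorExp
  choose c hc using hcond
  obtain ⟨ϖ, hϖ⟩ := exists_uniformizers (K := K)
  set cnt : HeightOneSpectrum (𝓞 K) → ℕ := fun v => (Associates.mk v.asIdeal).count (Associates.mk 𝔫₁).factors with hcnt
  set e : HeightOneSpectrum (𝓞 K) → ℤ := fun v => max (max (c v) 0) (cnt v : ℤ) with he
  have hH : ∀ v, SpreadHyp (K := K) c e ϖ v := fun v =>
    { cond := fun y hy => (hc v).1 y ((mem_primePowBall_adicCompletion_iff (v := v)).2 hy)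
      e_nonneg := le_trans (le_max_right _ _) (le_max_left _ _)
      c_le_e := le_trans (le_max_left _ _) (le_max_left _ _)
      unif := hϖ v }
  have hrad : ∀ v, exp (-e v) ≤ idealRadius K v 𝔫₁ := fun v => by
    rw [idealRadius_eq_exp_neg_natCast v h𝔫₁, exp_le_exp, neg_le_neg_iff]
    exact le_max_right _ _
  -- the places, the vector, the level
  set T : Finset (HeightOneSpectrum (𝓞 K)) := T₀ ∪ (Ideal.finite_factors h𝔫₁).toFinset with hT
  set L : List (HeightOneSpectrum (𝓞 K)) := T.toList with hL
  have hnd : L.Nodup := Finset.nodup_toList T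
  have hLT : ∀ v, v ∈ L ↔ v ∈ T := fun v => Finset.mem_toList
  set k : HeightOneSpectrum (𝓞 K) → ℕ := fun v => spreadK (n + 1) (c v) (e v) with hk
  set f : P.1.toSubmodule := spreadIter P.1 c e ϖ L f₁ with hf
  set 𝔫 : Ideal (𝓞 K) := spreadLevelIdeal 𝔫₁ k L with h𝔫def
  have h𝔫 : 𝔫 ≠ 0 := spreadLevelIdeal_ne_zero h𝔫₁ k L
  have hprimes : ∀ v : HeightOneSpectrum (𝓞 K), v.asIdeal ∣ 𝔫 → v ∈ T := by
    intro v hv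
    rcases mem_or_dvd_of_dvd_spreadLevelIdeal k hv with h | h
    · exact Finset.mem_union_right _ ((Ideal.finite_factors h𝔫₁).mem_toFinset.2 h)
    · exact (hLT v).1 h
  have hffix : ∀ g ∈ principalCongruenceLevel (n + 1) K 𝔫, P.1.toContRep g f = f :=
    toContRep_spreadIter_of_mem_principalCongruenceLevel h𝔫₁ (fun v _ => hH v) hnd hf₁fix
  have hffixK : ∀ u ∈ finitePrincipalCongruenceLevel (n + 1) K 𝔫, P.1.toContRep (GLn.ofFinite (n + 1) K u) f = f :=
    fun u hu => hffix _ (mem_finitePrincipalCongruenceLevel_iff.1 hu)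
  have hKo := isOpen_finitePrincipalCongruenceLevel (n + 1) K h𝔫
  have hKc := isCompact_finitePrincipalCongruenceLevel (n + 1) K h𝔫
  set η : GL (Fin (n + 1)) (AdeleRing (𝓞 K) K) → ℝ := archLevelWeight (finitePrincipalCongruenceLevel (n + 1) K 𝔫) β with hηdef
  have hη : IsTestFunctionGL (n + 1) K η :=
    isTestFunctionGL_archLevelWeight hβc hβs (fun u => contDiff_coe_comp_mul_expGL hψ u) hKo hKc
  have hηleft : ∀ u ∈ finitePrincipalCongruenceLevel (n + 1) K 𝔫, ∀ g : GL (Fin (n + 1)) (AdeleRing (𝓞 K) K),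
      η (GLn.ofFinite (n + 1) K u * g) = η g := fun u hu g => archLevelWeight_ofFinite_mul β hu g
  have hηleft' : ∀ k' : (AdelicGroupData.gl (n + 1) K).Adelic, k' ∈ principalCongruenceLevel (n + 1) K 𝔫 →
      ∀ g : (AdelicGroupData.gl (n + 1) K).Adelic, η (k' * g) = η g := by
    intro k' hk' g
    have h1 : GLn.ofFinite (n + 1) K (GLn.sndHom (n + 1) K k') = k' :=
      GLn.ofFinite_sndHom_of_mem (principalCongruenceLevel_le (n + 1) K 𝔫 hk')
    have h2 : GLn.sndHom (n + 1) K k' ∈ finitePrincipalCongruenceLevel (n + 1) K 𝔫 := by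
      rw [mem_finitePrincipalCongruenceLevel_iff, h1]; exact hk'
    have h3 := hηleft _ h2 g
    rwa [h1] at h3
  -- the initial smoothed vector `x₁` and the formula `S_η f = a • E_L x₁`
  set η₁ : GL (Fin (n + 1)) (AdeleRing (𝓞 K) K) → ℝ := archLevelWeight (finitePrincipalCongruenceLevel (n + 1) K 𝔫₁) β with hη₁def
  have hK₁o := isOpen_finitePrincipalCongruenceLevel (n + 1) K h𝔫₁
  have hK₁c := isCompact_finitePrincipalCongruenceLevel (n + 1) K h𝔫₁
  have hη₁ : IsTestFunctionGL (n + 1) K η₁ :=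
    isTestFunctionGL_archLevelWeight hβc hβs (fun u => contDiff_coe_comp_mul_expGL hψ u) hK₁o hK₁c
  set x₁ : P.1.toSubmodule := smoothedVector P.1 η₁ f₁ with hx₁
  have hx₁G : x₁ ∈ gardingSpace P.1 := smoothedVector_mem_gardingSpace hη₁ f₁
  have hx₁fix : ∀ g ∈ principalCongruenceLevel (n + 1) K 𝔫₁, P.1.toContRep g x₁ = x₁ := by
    intro g hg
    rw [hx₁, toContRep_smoothedVector_eq _ hη₁.continuous hη₁.hasCompactSupport g f₁]
    congr 1
    funext x
    have h1 : GLn.ofFinite (n + 1) K (GLn.sndHom (n + 1) K g⁻¹) = g⁻¹ :=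
      GLn.ofFinite_sndHom_of_mem (principalCongruenceLevel_le (n + 1) K 𝔫₁ (inv_mem hg))
    have h2 : GLn.sndHom (n + 1) K g⁻¹ ∈ finitePrincipalCongruenceLevel (n + 1) K 𝔫₁ := by
      rw [mem_finitePrincipalCongruenceLevel_iff, h1]; exact inv_mem hg
    have h3 := archLevelWeight_ofFinite_mul β h2 x
    rw [h1] at h3
    exact h3
  have hf₁fixK : ∀ u ∈ finitePrincipalCongruenceLevel (n + 1) K 𝔫₁, P.1.toContRep (GLn.ofFinite (n + 1) K u) f₁ = f₁ :=
    fun u hu => hf₁fix _ (mem_finitePrincipalCongruenceLevel_iff.1 hu)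
  set c𝔫 : ℝ := (archShadowConst (n := n + 1) (K := K) hKo
    (by rw [((finitePrincipalCongruenceLevel (n + 1) K 𝔫).isClosed_of_isOpen hKo).closure_eq]; exact hKc) : ℝ) with hc𝔫
  set c₁ : ℝ := (archShadowConst (n := n + 1) (K := K) hK₁o
    (by rw [((finitePrincipalCongruenceLevel (n + 1) K 𝔫₁).isClosed_of_isOpen hK₁o).closure_eq]; exact hK₁c) : ℝ) with hc₁
  have hc₁pos : 0 < c₁ := archShadowConst_pos _ hK₁o hK₁c
  have hc𝔫pos : 0 < c𝔫 := archShadowConst_pos _ hKo hKc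
  have hI : ∫ h, (β h : ℂ) • P.1.toContRep (GLn.ofInfinite (n + 1) K h) f₁ ∂(archHaar (n + 1) K) = ((c₁⁻¹ : ℝ) : ℂ) • x₁ := by
    rw [hx₁, hη₁def, smoothedVector_archLevelWeight_eq_smul_archIntegral hβc hβs hK₁o hK₁c hf₁fixK, smul_smul]
    push_cast
    rw [inv_mul_cancel₀ (by exact_mod_cast hc₁pos.ne'), one_smul]
  have hu : smoothedVector P.1 η f = ((c𝔫 * c₁⁻¹ : ℝ) : ℂ) • spreadIter P.1 c e ϖ L x₁ := by
    rw [hηdef, smoothedVector_archLevelWeight_eq_smul_archIntegral hβc hβs hKo hKc hffixK, hf,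
      ← spreadIter_archIntegral (fun v _ => hH v) hβc hβs, hI, spreadIter_smul, smul_smul]
    push_cast
    rfl
  -- the depth
  set m : ℕ := 1 + ∑ v ∈ T, (spreadM (c v) (e v) + n * (spreadM (c v) (e v) - c v)).toNat with hm
  have hmv : ∀ v ∈ T, spreadM (c v) (e v) + n * (spreadM (c v) (e v) - c v) ≤ m := by
    intro v hv
    have h1 : (spreadM (c v) (e v) + n * (spreadM (c v) (e v) - c v)).toNat ≤
        ∑ w ∈ T, (spreadM (c w) (e w) + n * (spreadM (c w) (e w) - c w)).toNat :=
      Finset.single_le_sum (f := fun w => (spreadM (c w) (e w) + n * (spreadM (c w) (e w) - c w)).toNat)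
        (fun _ _ => Nat.zero_le _) hv
    have h2 := Int.self_le_toNat (spreadM (c v) (e v) + n * (spreadM (c v) (e v) - c v))
    have h3 : ((∑ w ∈ T, (spreadM (c w) (e w) + n * (spreadM (c w) (e w) - c w)).toNat : ℕ) : ℤ) ≤ (m : ℤ) := by
      rw [hm]; exact_mod_cast Nat.le_add_left _ _
    calc spreadM (c v) (e v) + n * (spreadM (c v) (e v) - c v)
        ≤ ((spreadM (c v) (e v) + n * (spreadM (c v) (e v) - c v)).toNat : ℤ) := h2
      _ ≤ ((∑ w ∈ T, (spreadM (c w) (e w) + n * (spreadM (c w) (e w) - c w)).toNat : ℕ) : ℤ) := by exact_mod_cast h1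
      _ ≤ m := h3
  refine ⟨T, Finset.subset_union_left, m, 𝔫, h𝔫, hprimes, f, η, hη, hηleft, hηleft', fun ν₀ hν₀ => ?_, by omega,
    fun ν₀ hν₀ v hv => ?_⟩
  · -- non-vanishing at `1`
    haveI := hν₀
    have huG : smoothedVector P.1 η f ∈ gardingSpace P.1 := smoothedVector_mem_gardingSpace hη f
    obtain ⟨hEG, hℓ⟩ := whittakerFunctional_spreadIter ν₀ h𝔫₁ (fun v _ => hH v) hnd (fun v _ => hrad v) hx₁G hx₁fix
      (W := P.1) (c := c) (e := e) (ϖ := ϖ) (L := L)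
    have hWu := whittakerFunctional_toContRep_eq_whittakerCoeff ν₀ (continuous_adeleAddChar K) huG
      (hasContRep_smoothedVector P.1 hη.continuous hη.hasCompactSupport f) 1
    have hWx := whittakerFunctional_toContRep_eq_whittakerCoeff ν₀ (continuous_adeleAddChar K) hx₁G
      (hasContRep_smoothedVector P.1 hη₁.continuous hη₁.hasCompactSupport f₁) 1
    change whittakerCoeff ν₀ (unipotentTateDomain (n + 1) K) (adeleAddChar K)
      (invQuot (AdelicGroupData.gl (n + 1) K) (smoothedForm η (f : (AdelicGroupData.gl (n + 1) K).L2 μ))) 1 ≠ 0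
    rw [← hWu]
    have hvec : (⟨P.1.toContRep 1 (smoothedVector P.1 η f), toContRep_mem_gardingSpace _ huG⟩ : gardingSpace P.1) =
        ((c𝔫 * c₁⁻¹ : ℝ) : ℂ) • ⟨spreadIter P.1 c e ϖ L x₁, hEG⟩ := by
      apply Subtype.ext
      change P.1.toContRep 1 (smoothedVector P.1 η f) = ((c𝔫 * c₁⁻¹ : ℝ) : ℂ) • spreadIter P.1 c e ϖ L x₁
      rw [DFunLike.congr_fun (map_one P.1.toContRep) (smoothedVector P.1 η f)]
      exact hu
    have hvec1 : (⟨x₁, hx₁G⟩ : gardingSpace P.1) = ⟨P.1.toContRep 1 x₁, toContRep_mem_gardingSpace _ hx₁G⟩ := by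
      apply Subtype.ext
      exact (DFunLike.congr_fun (map_one P.1.toContRep) x₁).symm
    rw [hvec, map_smul, smul_eq_mul, hℓ, hvec1, hWx]
    exact mul_ne_zero (by exact_mod_cast (mul_pos hc𝔫pos (inv_pos.2 hc₁pos)).ne') (hW1 ν₀ hν₀)
  · -- the data at `v ∈ T`
    haveI := hν₀
    have hv' : v ∈ L := (hLT v).2 hv
    have hisoF := isotypic_spreadIter (W := P.1) (fun v _ => hH v) hnd f₁ v hv'
    have hisoI := isotypic_archIntegral hisoF hβc hβs
    have hiso : ∀ h ∈ spreadLevelGroup (spreadTorus (n + 1) (ϖ v) (c v) (e v)) (spreadM (c v) (e v)),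
        P.1.toContRep (GLn.ofLocal (n + 1) K v h) (smoothedVector P.1 η f) = spreadChar v h • smoothedVector P.1 η f := by
      intro h hh
      rw [hηdef, smoothedVector_archLevelWeight_eq_smul_archIntegral hβc hβs hKo hKc hffixK, map_smul, hf, hisoI h hh,
        smul_comm]
    obtain ⟨x, hx, hx1⟩ := (hc v).2
    refine ⟨spreadTorus (n + 1) (ϖ v) (c v) (e v), spreadM (c v) (e v), c v,
      isSpreadWhittakerAt_of_isotypic ν₀ (le_trans zero_le_one (one_le_spreadM (hH v).e_nonneg)) (hH v).hψ hη f hiso,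
      ⟨x, ?_, hx1⟩, one_le_spreadM (hH v).e_nonneg, valuation_spreadTorus_antitone (hH v).e_nonneg (hH v).unif,
      valuation_spreadTorus_gap (hH v).unif, valuation_spreadTorus_depth (hH v).unif (hmv v hv)⟩
    have h1 := (mem_primePowBall_adicCompletion_iff (v := v)).1 hx
    rwa [show (-(c v - 1) : ℤ) = 1 - c v by ring] at h1

end Final

end Literature.NumberTheory.Automorphic

end Part_SpreadDatumFinal

/-! ## Part 4 — Arthur–Clozel (2.3) in every rank from the archimedean Rankin–Selberg convergence -/

/-!
# Arthur–Clozel (2.3) in every rank from the archimedean Rankin–Selberg convergence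

Topic `NumberTheory/Automorphic`; namespace `Literature.NumberTheory.Automorphic`. The named fact
`JacquetShalika1981_partialPairL_pole_of_eq_conj` — for cuspidal `π` of `GL_n(𝔸_K)` and `π' = π̄ ≅ π̃`,
`(s - 1) L^S(s, π × π') → c ≠ 0` as `s → 1⁺` (Jacquet–Shalika (1981), Thm. (5.3); Arthur–Clozel (1989),
Ch. 3 (2.3)) — is proved here in EVERY rank `n ≥ 1` FROM Jacquet–Shalika's archimedean theorem,
taken as the explicit hypothesis `hX`: for every irreducible unitary strongly continuous representation
`τ` of `GL_n(K_∞)`, every continuous `ψ_∞`-Whittaker functional on its Gårding space, every Gårding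
vector and all Haar measures, `archRankinSelbergLIntegral … < ∞` (absolute convergence at `s = 1` of
the archimedean Rankin–Selberg integrals `Ψ_∞(1; W, W̄, Φ^{Gauss})`; Cogdell (2004), §3.1 item (1)
with §3.2;
Jacquet–Shalika (1981), §3; Jacquet–Shalika (1990), §5 — for `n ≥ 3` this rests on the asymptotics of
archimedean Whittaker functions and is not proved in the tree; by D-0026 it is not vendored as a
named fact here either). The finite places are treated unconditionally and elementarily:

* the reduction to the first moment of a thin datum at `s = 1`
  (`JacquetShalika1981_partialPairL_pole_of_eq_conj_of_thinFirstMoment`);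
* the spread test datum (`exists_spreadDatum`): `W(1) ≠ 0` and spread bi-equivariance at the bad
  places, so that the thin first moment is dominated by the unit-box first moment of the standard
  datum (`setLIntegral_torusIntegrand_thin_le`, the support theorem of `WhittakerBiEquivariantSupport`);
* the archimedean bridge (`setLIntegral_unitBox_univ_torusIntegrand_lt_top`): the unit-box first moment
  is a finite sum of archimedean Rankin–Selberg integrals of the archimedean component.

## Main statements

* `JacquetShalika1981_partialPairL_pole_of_eq_conj_of_archRankinSelbergConvergence`: rank `n + 1`.
* `JacquetShalika1981_partialPairL_pole_of_eq_conj_of_archRankinSelbergConvergence'`: every rank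
  (rank `0` is excluded by the hypothesis `0 < n` of the fact).

## References

* H. Jacquet, J. A. Shalika, *On Euler products and the classification of automorphic
  representations I, II*, Amer. J. Math. 103 (1981), Thm. (5.3), §4; II Prop. (3.6) [JacquetShalikaAJM1981].
* J. Arthur, L. Clozel, *Simple algebras, base change, and the advanced theory of the trace
  formula* (1989), Ch. 3, (2.3) [ArthurClozelAMS120].
* J. W. Cogdell, *Analytic theory of L-functions for GL_n* (2004), §3.2, §4.2 [CogdellAnalyticTheory2004].
-/

noncomputable section Part_PairLFunctionPolesEqConjArch

open MeasureTheory Measure NumberField NumberField.mixedEmbedding IsDedekindDomain Set Filter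
open Literature.NumberTheory.GaloisRepresentations (ideleGroup)
open scoped MatrixGroups ENNReal Classical

namespace Literature.NumberTheory.Automorphic

variable {n : ℕ} {K : Type} [Field K] [NumberField K]
variable {μ' : Measure (AdelicGroupData.gl (n + 1) K).automorphicQuotient}
  [(AdelicGroupData.gl (n + 1) K).IsAutomorphicMeasure μ']

attribute [local instance] adelicBorel borelSpace_adelic locallyCompactSpace_adelic secondCountableTopology_gl_adelic
  glAdeleBorel borelSpace_glAdele glInfBorel borelSpace_glInf locallyCompactSpace_glInf secondCountableTopology_glInf

/-- **Arthur–Clozel (2.3) in rank `n + 1` from the archimedean Rankin–Selberg convergence.** Assume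
the archimedean Rankin–Selberg integrals of irreducible unitary representations of `GL_{n+1}(K_∞)`
converge absolutely at `s = 1` (hypothesis `hX`, `archRankinSelbergLIntegral … < ∞`; Jacquet–Shalika's
archimedean theorem, Cogdell (2004), §3.1 (1), §3.2). Then for every cuspidal
automorphic representation `π` of `GL_{n+1}(𝔸_K)`, with `π' = π̄`, `(s - 1) L^S(s, π × π')` tends to a
non-zero limit as `s → 1⁺` in `re s > 1` (the named fact `JacquetShalika1981_partialPairL_pole_of_eq_conj`).
[cite: JacquetShalikaAJM1981, Thm. (5.3), §4] [cite: ArthurClozelAMS120, Ch. 3 §2 (2.3)] -/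
theorem JacquetShalika1981_partialPairL_pole_of_eq_conj_of_archRankinSelbergConvergence
    (hX : ∀ (hcpt : isCompact_glFiniteIntegralLevel (n + 1) K) (E : Type) [NormedAddCommGroup E]
      [InnerProductSpace ℂ E] [CompleteSpace E]
      (τ : ContRepresentation ℂ (AutomorphyDatum.gl (n + 1) K hcpt).arch.carrier E) (hτ : τ.IsStronglyContinuous)
      (_ : τ.IsUnitary) (_ : τ.IsTopIrreducible)
      (ℓ : archGardingSpace hcpt τ →ₗ[ℂ] ℂ) (_ : IsArchContWhittakerFunctional hcpt τ hτ ℓ)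
      (e : archGardingSpace hcpt τ)
      [MeasurableSpace (GL (Fin (n + 1)) (mixedSpace K))] [BorelSpace (GL (Fin (n + 1)) (mixedSpace K))]
      [MeasurableSpace ((mixedSpace K)ˣ)] [BorelSpace ((mixedSpace K)ˣ)]
      (μA : Measure (Fin (n + 1) → (mixedSpace K)ˣ)) (_ : IsHaarMeasure μA)
      (μK : Measure ↥(Kinf (n + 1) K)) (_ : IsHaarMeasure μK),
      archRankinSelbergLIntegral hcpt τ hτ ℓ e μA μK < ⊤) :
    JacquetShalika1981_partialPairL_pole_of_eq_conj (n := n + 1) (K := K) (μ := μ') := by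
  refine JacquetShalika1981_partialPairL_pole_of_eq_conj_of_thinFirstMoment ?_
  intro _ _ P T₀
  obtain ⟨T, hT₀, m, 𝔫, h𝔫, hprimes, f, η, hη, hηleft, hηleft', hW1, hm, hdata⟩ := exists_spreadDatum P T₀
  refine ⟨T, hT₀, m, 𝔫, h𝔫, hprimes, f, η, hη, hηleft', hW1, fun νA hνA νK hνK ν₀ hν₀ => ?_⟩
  haveI := hνA; haveI := hνK; haveI := hν₀
  haveI := borelSpace_ideleGroup K
  haveI hν₀R : ν₀.IsMulRightInvariant := isMulRightInvariant_of_isHaarMeasure_adelicUnipotent ν₀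
  -- the Whittaker coefficient: left `N`-equivariance and central insensitivity
  set W : GL (Fin (n + 1)) (AdeleRing (𝓞 K) K) → ℂ := whittakerCoeff ν₀ (unipotentTateDomain (n + 1) K) (adeleAddChar K)
    (invQuot (AdelicGroupData.gl (n + 1) K) (smoothedForm η (f : (AdelicGroupData.gl (n + 1) K).L2 μ'))) with hW
  have hφinv : IsLeftInvariant (AdelicGroupData.gl (n + 1) K)
      (invQuot (AdelicGroupData.gl (n + 1) K) (smoothedForm η (f : (AdelicGroupData.gl (n + 1) K).L2 μ'))) :=
    isLeftInvariant_invQuot _ _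
  have hWN : ∀ (u : ↥(adelicUnipotent (n + 1) K)) (g : GL (Fin (n + 1)) (AdeleRing (𝓞 K) K)),
      W ((u : GL (Fin (n + 1)) (AdeleRing (𝓞 K) K)) * g) = whittakerCharFun (adeleAddChar K) u * W g := fun u g =>
    whittakerCoeff_unipotent_mul (ν := ν₀) (𝓕 := unipotentTateDomain (n + 1) K) (ψ := adeleAddChar K)
      (isFundamentalDomain_unipotentTateDomain ν₀) (isGlobalAddChar_adeleAddChar (K := K)) hφinv u g
  obtain ⟨ω, hωu, -, -, -, -, hω⟩ := P.exists_centralCharacter_smoothedForm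
  have hWZ : ∀ (z : ideleGroup K) (g : GL (Fin (n + 1)) (AdeleRing (𝓞 K) K)),
      ‖W (Matrix.GeneralLinearGroup.scalar (Fin (n + 1)) z * g)‖ = ‖W g‖ := by
    intro z g
    rw [hW, whittakerCoeff_scalar_mul (fun g => hω η f z g), norm_mul, hωu z, one_mul]
  -- the thin first moment is dominated by the unit-box first moment, finite by the bridge
  have hle := setLIntegral_torusIntegrand_thin_le (ψ := adeleAddChar K) (W := W) hWN hWZ hm (hdata ν₀ hν₀)
    (Φinf := gaussArchTestFun (n + 1) K) (fun z => (gaussArchTestFun_pos (n + 1) K z).le) 1 νA νK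
  have hlt := setLIntegral_unitBox_univ_torusIntegrand_lt_top hX P h𝔫 hη hηleft f νA νK ν₀
  exact ne_of_lt (lt_of_le_of_lt hle hlt)

/-- **Arthur–Clozel (2.3) in every rank from the archimedean Rankin–Selberg convergence** (rank `0` is
excluded by the hypothesis `0 < n` of the fact). [cite: JacquetShalikaAJM1981, Thm. (5.3), §4]
[cite: ArthurClozelAMS120, Ch. 3 §2 (2.3)] -/
theorem JacquetShalika1981_partialPairL_pole_of_eq_conj_of_archRankinSelbergConvergence' {N : ℕ}
    {μ : Measure (AdelicGroupData.gl N K).automorphicQuotient} [(AdelicGroupData.gl N K).IsAutomorphicMeasure μ]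
    (hX : ∀ (hcpt : isCompact_glFiniteIntegralLevel N K) (E : Type) [NormedAddCommGroup E]
      [InnerProductSpace ℂ E] [CompleteSpace E]
      (τ : ContRepresentation ℂ (AutomorphyDatum.gl N K hcpt).arch.carrier E) (hτ : τ.IsStronglyContinuous)
      (_ : τ.IsUnitary) (_ : τ.IsTopIrreducible)
      (ℓ : archGardingSpace hcpt τ →ₗ[ℂ] ℂ) (_ : IsArchContWhittakerFunctional hcpt τ hτ ℓ)
      (e : archGardingSpace hcpt τ)
      [MeasurableSpace (GL (Fin N) (mixedSpace K))] [BorelSpace (GL (Fin N) (mixedSpace K))]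
      [MeasurableSpace ((mixedSpace K)ˣ)] [BorelSpace ((mixedSpace K)ˣ)]
      (μA : Measure (Fin N → (mixedSpace K)ˣ)) (_ : IsHaarMeasure μA)
      (μK : Measure ↥(Kinf N K)) (_ : IsHaarMeasure μK),
      archRankinSelbergLIntegral hcpt τ hτ ℓ e μA μK < ⊤) :
    JacquetShalika1981_partialPairL_pole_of_eq_conj (n := N) (K := K) (μ := μ) := by
  cases N with
  | zero => intro hn; exact absurd hn (lt_irrefl 0)
  | succ n => exact JacquetShalika1981_partialPairL_pole_of_eq_conj_of_archRankinSelbergConvergence hX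

end Literature.NumberTheory.Automorphic

end Part_PairLFunctionPolesEqConjArch
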